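import Summits.FinalStateConjecture.FinalStateConjecture.Theses.ZeroEnergyKerrOrBomb
import Summits.FinalStateConjecture.FinalStateConjecture.Theses.SwallowTheDatum
import Summits.FinalStateConjecture.FinalStateConjecture.Theses.PhaseMixingCapture
import Literature.Geometry.Lorentzian.TameGenericityDiagonal
import Summits.FinalStateConjecture.FinalStateConjecture.Theorems.ZeroEnergyKerrOrBombSymplecticDualOfTheBombSig4
import Summits.FinalStateConjecture.FinalStateConjecture.Theorems.ZeroEnergyKerrOrBombStationaryLimitReductionKerrIsometryRigidityWave3EndMatching
import Summits.FinalStateConjecture.FinalStateConjecture.Theorems.ZeroEnergyKerrOrBombStationaryLimitReductionRecutCoveringJunctionCore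
import Summits.FinalStateConjecture.FinalStateConjecture.Theorems.ZeroEnergyKerrOrBombStationaryLimitReductionMoncriefDualityReductionWave3
import Summits.FinalStateConjecture.FinalStateConjecture.Theorems.ZeroEnergyKerrOrBombStationaryLimitReductionMoncriefFactsWave3
import Summits.FinalStateConjecture.FinalStateConjecture.Theorems.ZeroEnergyKerrOrBombStationaryLimitReductionDualModeEjectionWave3
import Summits.FinalStateConjecture.FinalStateConjecture.Theorems.ZeroEnergyKerrOrBombStationaryLimitReductionProbeUniversalityWave3
import Literature.Geometry.Lorentzian.KerrKillingAlgebraProofs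
import Literature.Geometry.Lorentzian.KerrBackwardsIsometryProofs
import Literature.Geometry.Lorentzian.SchwarzschildKillingAlgebraProofs
import Literature.Geometry.Lorentzian.LocalConstraintDeformation
import Literature.Geometry.Lorentzian.TameFamilyOffCompact
import Literature.Geometry.Lorentzian.TameGenericityLocalWindow
import Summits.FinalStateConjecture.FinalStateConjecture.Theorems.ZeroEnergyKerrOrBombSymplecticDualOfTheBombDefs2
import Summits.FinalStateConjecture.FinalStateConjecture.Theorems.ZeroEnergyKerrOrBombOneLockedExplosionDefs
import Summits.FinalStateConjecture.FinalStateConjecture.Theorems.ZeroEnergyKerrOrBombStationaryLimitReductionTimeEquivariantMaps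
import Summits.FinalStateConjecture.FinalStateConjecture.Theorems.BartnikGapSettlingGapExhaustionFutureDirectedDichotomy
import Literature.Geometry.Lorentzian.StationaryBlackHoleUniquenessProofs
import Literature.Geometry.Lorentzian.KerrSchildCoord
import Literature.Geometry.Lorentzian.KerrDataProofs
import Literature.Geometry.Lorentzian.KerrHyperboloidalLeaves
import Literature.Geometry.Lorentzian.TimeCones
import Summits.FinalStateConjecture.FinalStateConjecture.Theorems.ZeroEnergyKerrOrBombStationaryLimitReductionStubChartTransfer
import Summits.FinalStateConjecture.FinalStateConjecture.Theorems.ZeroEnergyKerrOrBombStationaryLimitReductionRecutSets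
import Summits.FinalStateConjecture.FinalStateConjecture.Statement
import Literature.Geometry.Lorentzian.CausalityPushUp
import Literature.Geometry.Lorentzian.KerrSchildFrame
import Literature.Geometry.Lorentzian.KerrFluxComparison
import HarnessLib

/-!
# Line `SketchIdeator1` (idea card `Ideas/rays-not-modes.md`) — crux `FinalStateFromKerrOrBomb`
# (route ZeroEnergyKerrOrBomb, item stmt-FinalStateConjecture-17839): CHECKED SKELETON, shape m1
# = the registered r7 skeleton of the predecessor crux 10021 (`Cruxes/StationaryLimitReduction/Lines/symplectic_dual_of_the_bomb.lean`)
# TRANSFERRED to the rev-9 frame and DOCKED THROUGH X = `KerrOrBombModT`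

Crux (fixed, the route's): `FinalStateFromKerrOrBomb : Prop := KerrOrBombModT → FinalStateConjecture`.

WHY THIS SHAPE (lead prover-line-stmt-FinalStateConjecture-17839-0, lineage 0, 2026-08-17; `PICKED.md`). The crux's informal
statement: "MONDAY MORNING: the registered line Cruxes/StationaryLimitReduction/Lines/symplectic_dual_of_the_bomb.lean (reshape r7,
7 stubs; 30+ landed files incl. stub_chartTransfer p120456) transfers with `InTelescope` := this telescope + mode stability; its hard
stubs (nonSettlingCure = WCC + settling; dualModeEjection = Moncrief duality of the bomb) are telescope-agnostic." This file IS that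
transfer. The one payload line of this seat (`SketchIdeator1` = the first-lemma file of card rays-not-modes: `opticalDock`,
`opticalHair_of`, typed shapes; no `_of`) is honoured as the ALTERNATIVE DOCK: its lever (dock at `Γ₀ = ∅` through the co-hypotheses
`hN : NonTrappingHawkingRigidity`, `hD : HawkingExtensionIsKerr` of `closes`, repel the rest by trapping type) is one `Q`-swap of the
settling currency away (`Q := InTelescopeModT ∧ ¬ trapped`), but makes X idle (finding 3 of `NotesIdeator2.md`) and the item
conditional on stmt-13896 ∧ stmt-17840 — a planner-level retarget; the X-dock below keeps the crux AS TYPED load-bearing.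

## Shape m1 → m2 → m3 → m4 (7 registered stubs = stubs_max; m2 = junction core ORIENTED; m3 = F5 and 1F-T2 DISCHARGED (p135232, p136225, inlined §L), 1R split into F3 / F4;
## m4 = junction core RESTATED over the chart-overlap clause added to the currency — the oriented core was REFUTED as typed, wave 4;
## m5 = BOOST-HONEST currency `HasExhaustiveDocChartsB` + `IsChartOverlapCompatibleB` (wave-6 audit: the m4 binders forced isochronous motions) and core `stub_recutJunctionCoreB`;
## the T2 chart transfer is consumed over clause (ii) alone (`chartTransferT2_of_ii`, p136225 re-run);
## m6 = the crux SPLIT AT WEAK COSMIC CENSORSHIP in relative form (strategist s1): `WeakCosmicCensorshipTame` (stmt-17269) cited BY NAME, stub 2′ → 2′-rel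
## (censorship-escape curve handed in), composition along curves (`isTameChristodoulouGeneric_of_relative_exceptional`))

* `InTelescopeModT 𝓑` (§0M) — VERBATIM the hypothesis prefix of `KerrOrBombModT` before "Killing-mode-stable" (vacuum, `I⁺`-regular,
  future-presented, `T ≠ 0` on a simply connected d.o.c., a Killing–timelike collar `(U, K)` on the connected horizon, belt compact
  mod `T`), bundled with `∃ U K`; `ModeStableModT := InTelescopeModT ∧ ModeStable`. The DOCK `isKerrExterior_of_kerrOrBombModT :
  KerrOrBombModT → InTelescopeModT 𝓑 → ModeStable 𝓑 → IsKerrExterior 𝓑` is pure logic (§3). PRESENTABILITY of the limit holes in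
  the rev-6 telescope (future-presentation = the landed WLOG step S1b p115302; `π₁(doc) = 0` = topological censorship; collar =
  smooth local rigidity + the Gaussian-null sign lemma `κ > 0`; belt from AF + `I⁺`-regularity) is owed INSIDE the settling stubs,
  where it is an honest clause of "settles to holes of the telescope", and NOT as a telescope-transfer stub `InTelescope →
  InTelescopeModT` (false as typed: the rev-4 `IsNonDegenerateHorizon` field need not commute with `T` nor be timelike off `𝓗⁺`).
* currency: r7's `SettlesDocWithT2 Q` (inlined §0, Sig7 p130945 is accepted but not yet built on the farm) instantiated with
  `Q := InTelescopeModT` (Case split) and `Q := ModeStableModT` (good members). It still carries the rev-4 `InTelescope (d.hole i)` and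
  `(d.hole i).IsIPlusRegular`, so every BACK stub keeps its landed statement and reductions:
  1R `stub_kerrIsometryResiduals` (F3 ∧ F4 ∧ F5; p126702 reduction, Kerr facts discharged p127724/p129316), 1G-core
  `stub_recutJunctionCore` (p125072), 1F-T2 `stub_chartTransferT2` (landed transfer p121011/p130371 + ray clause + orientation),
  3 `stub_probeUniversality` (the Bridge — the one stub that makes X load-bearing), 4-residuals `stub_moncriefResiduals`
  (Chruściel–Delay fact ∧ `LocalSingleDetectionAt`, p124601/p124620).
* FRONT stubs re-typed to the ModT currency (§1M): 2′ `stub_nonSettlingCureModT` (antecedent: does not settle PRESENTABLY, or settles with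
  a Killing germ everywhere; conclusion: tame immersed injective admissible curve whose members off `0` settle to `ModeStableModT`
  holes — open problem, LEAD) and 5′ `stub_dualModeEjectionModT` (r7 stub 5 with `InTelescopeModT` among the per-hole hypotheses and
  `ModeStableModT` in the conclusion).
* composition (§4): `FinalStateFromKerrOrBomb_of : MGHDExists → 7 stubs → FinalStateFromKerrOrBomb`; `intro hX`; X consumed at the dock
  of every good member; datum-wise (Disproof §5 of the predecessor: ∧-non-closure of curve genericity), window lemma
  `isTameChristodoulouGeneric_of_localWindow` (p130530).
-/

/-! ## §L LANDED THIS LINE, inlined verbatim until the farm builds their modules (then replaced by `import`):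
`Theorems/ZeroEnergyKerrOrBombFinalStateFromKerrOrBombKerrIdentificationFuture.lean` (p135232, F5 `kerrIdentificationFuture`)
and `Theorems/ZeroEnergyKerrOrBombFinalStateFromKerrOrBombChartTransferT2.lean` (p136225, `chartTransferT2_unfolded`).
Byte-identical bodies (module docstrings dropped); same namespace `…Theorems.SymplecticDualOfTheBomb` as in the tree. -/

-- ===== BEGIN inlined copy of p135232 (KerrIdentificationFuture) =====
set_option linter.dupNamespace false

-- instance search through the nested operator types `E4 →L[ℝ] E4 →L[ℝ] ℝ`
set_option maxSynthPendingDepth 3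

noncomputable section

open scoped Manifold ContDiff Topology
open Set Filter Function

namespace Summit.FinalStateConjecture.FinalStateConjecture.Theorems.SymplecticDualOfTheBomb

open Literature.Geometry.Lorentzian Literature.Geometry.Manifold
open Summit.FinalStateConjecture.FinalStateConjecture.Theorems.OneLockedExplosion

/-! ## §1 Chain rule through the adapted chart for a corestriction of `Θ` -/

section Comp

variable {𝓑 : StationaryAFBlackHole.{0}} (A : 𝓑.AdaptedChart) {S : Set E4} {Θ : E4 → E4}
  {φ : E4 → A.domain}

/-- **Chain rule through the open submanifold `A.domain`.** If `φ : E4 → A.domain` corestricts `Θ` on the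
open set `S` (`↑(φ y) = Θ y` for `y ∈ S`) and `Θ` is differentiable at `x ∈ S`, then `A ∘ φ` has manifold
derivative `dA_{φ x} ∘ dΘ_x` at `x` (the corestriction has the derivative of `Θ`,
`OpensChart.hasMFDerivAt_codRestrict`; Lee, Prop. 3.9). [folklore] -/
theorem hasMFDerivAt_adaptedChart_comp (hS : IsOpen S) (hφ : ∀ x ∈ S, (φ x : E4) = Θ x) {x : E4}
    (hx : x ∈ S) (hd : DifferentiableAt ℝ Θ x) :
    HasMFDerivAt 𝓘(ℝ, E4) (𝓡 4) (A.toFun ∘ φ) x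
      ((mfderiv 𝓘(ℝ, E4) (𝓡 4) A.toFun (φ x)).comp (fderiv ℝ Θ x)) := by
  have h1 : HasMFDerivAt 𝓘(ℝ, E4) 𝓘(ℝ, E4) (Subtype.val ∘ φ) x (fderiv ℝ Θ x) :=
    (hasMFDerivAt_iff_hasFDerivAt.2 hd.hasFDerivAt).congr_of_eventuallyEq
      (Filter.eventuallyEq_of_mem (hS.mem_nhds hx) fun y hy ↦ hφ y hy)
  have h2 : HasMFDerivAt 𝓘(ℝ, E4) 𝓘(ℝ, E4) φ x (fderiv ℝ Θ x) :=
    OpensChart.hasMFDerivAt_codRestrict (f := Subtype.val ∘ φ) (fun _ ↦ rfl) h1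
  have h3 : HasMFDerivAt 𝓘(ℝ, E4) (𝓡 4) A.toFun (φ x) (mfderiv 𝓘(ℝ, E4) (𝓡 4) A.toFun (φ x)) :=
    (A.contMDiff.mdifferentiableAt (by simp)).hasMFDerivAt
  exact h3.comp x h2

/-- Pointwise form of the chain rule: `d(A ∘ φ)_x v = dA_{φ x} (dΘ_x v)`. [folklore] -/
theorem mfderiv_adaptedChart_comp_apply (hS : IsOpen S) (hφ : ∀ x ∈ S, (φ x : E4) = Θ x) {x : E4}
    (hx : x ∈ S) (hd : DifferentiableAt ℝ Θ x) (v : E4) :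
    mfderiv 𝓘(ℝ, E4) (𝓡 4) (A.toFun ∘ φ) x v =
      mfderiv 𝓘(ℝ, E4) (𝓡 4) A.toFun (φ x) (fderiv ℝ Θ x v) := by
  rw [(hasMFDerivAt_adaptedChart_comp A hS hφ hx hd).mfderiv]
  rfl

/-- `A ∘ φ` is `C^∞` on `S` when `Θ` is (the corestriction of a `C^∞` map to an open submanifold is
`C^∞`, `ContMDiffAt.subtypeVal_comp_iff`, composed with the `C^∞` chart map). [folklore] -/
theorem contMDiffOn_adaptedChart_comp (hS : IsOpen S) (hφ : ∀ x ∈ S, (φ x : E4) = Θ x)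
    (hΘ : ContDiffOn ℝ ∞ Θ S) : ContMDiffOn 𝓘(ℝ, E4) (𝓡 4) ∞ (A.toFun ∘ φ) S := by
  refine A.contMDiff.comp_contMDiffOn fun x hx ↦ ContMDiffAt.contMDiffWithinAt ?_
  have h1 : ContMDiffAt 𝓘(ℝ, E4) 𝓘(ℝ, E4) ∞ (Subtype.val ∘ φ) x :=
    (contMDiffAt_iff_contDiffAt.2 (hΘ.contDiffAt (hS.mem_nhds hx))).congr_of_eventuallyEq
      (Filter.eventuallyEq_of_mem (hS.mem_nhds hx) fun y hy ↦ hφ y hy)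
  exact (ContMDiffAt.subtypeVal_comp_iff A.domain φ x).1 h1

/-- **The chart components of `g` along `A ∘ φ` are those of `A.bilin` pulled back by `Θ`**:
`g(d(A ∘ φ) v, d(A ∘ φ) w) = A.bilin (Θ x) (dΘ v) (dΘ w)` (`A.bilin = A^* g`, field `bilin_eq`).
[folklore] -/
theorem metricInCoords_adaptedChart_comp (hS : IsOpen S) (hφ : ∀ x ∈ S, (φ x : E4) = Θ x) {x : E4}
    (hx : x ∈ S) (hd : DifferentiableAt ℝ Θ x) (v w : E4) :
    𝓑.toSpacetime.metricInCoords (A.toFun ∘ φ) x v w =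
      A.bilin (Θ x) (fderiv ℝ Θ x v) (fderiv ℝ Θ x w) := by
  rw [Spacetime.metricInCoords_apply, mfderiv_adaptedChart_comp_apply A hS hφ hx hd,
    mfderiv_adaptedChart_comp_apply A hS hφ hx hd, ← hφ x hx, A.bilin_eq (φ x)]
  rfl

end Comp

/-! ## §2–3 The registered helper -/

/-- **Stub 1R-F5 `kerrIdentificationFuture` (conjunct F5 of `stub_kerrIsometryResiduals`, line
`SketchIdeator1` of crux stmt-FinalStateConjecture-17839; the statement `Sig7.stub_kerrIdentificationFuture`
unfolded).** For a `T`-equivariant isometric Kerr identification `Θ` of a hole (`IsKerrChartedWith`), the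
push-forward by `A ∘ Θ` of Kerr's future timelike field `V_{M,a} = −g♯(dt*)` is future-directed for `𝓑` at
every point of the Kerr exterior. Proof: the pushed field is timelike (`g_{M,a}(V,V) < 0`, `Θ` isometric,
`A.bilin = A^* g`), hence of one orientation on the connected exterior (`stub_futureDirected_dichotomy`); at a
point charted into `M_ext` (which exists: `M_ext ≠ ∅`, `M_ext ⊆ doc`, anchor clause) it pairs negatively with
the future timelike `T = dA(e₀) = c⁻¹ dA(dΘ e₀)`: `g(T, dA dΘ V) = c⁻¹ g_{M,a}(e₀, V) = −c⁻¹ < 0`. The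
hypothesis `InTelescope 𝓑` is idle. [cite: ONeill1983, Ch. 5, Lemma 5.32] -/
theorem kerrIdentificationFuture : ∀ (𝓑 : StationaryAFBlackHole.{0}) (A : 𝓑.AdaptedChart) (M a c r₀ : ℝ) (Θ : E4 → E4), InTelescope 𝓑 → IsKerrChartedWith 𝓑 A M a c r₀ Θ → ∀ u ∈ (Kerr.exterior M a : Set E4), ∀ h : Θ u ∈ A.domain, 𝓑.timeOrientation.IsFutureDirected (mfderiv 𝓘(ℝ, E4) (𝓡 4) A.toFun ⟨Θ u, h⟩ (fderiv ℝ Θ u (Kerr.timeVector M a u))) := by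
  intro 𝓑 A M a c r₀ Θ _ hK u hu h
  classical
  haveI : 𝓑.metric.HasLeviCivita := 𝓑.metric.toPseudoRiemannianMetric.hasLeviCivita
  obtain ⟨hsub, hc, -, hr₀, hΘs, -, hmaps, heqv, hiso, hanchor, -⟩ := hK
  set S : Set E4 := (Kerr.exterior M a : Set E4) with hS_def
  set R : Set E4 := (Kerr.region a r₀ : Set E4) with hR_def
  have hSo : IsOpen S := (Kerr.exterior M a).isOpen
  have hRo : IsOpen R := (Kerr.region a r₀).isOpen
  have hSR : S ⊆ R := fun x hx ↦ Kerr.region_mono a hr₀.le hx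
  have hM : 0 ≤ M := hsub.pos.le
  have hrad : ∀ x ∈ S, 0 < Kerr.radius a x := fun x hx ↦ Kerr.radius_pos_of_mem_region hx
  -- differentiability of `Θ` on the exterior
  have hΘS : ContDiffOn ℝ ∞ Θ S := hΘs.mono hSR
  have hΘd : ∀ x ∈ S, DifferentiableAt ℝ Θ x := fun x hx ↦
    (hΘS.contDiffAt (hSo.mem_nhds hx)).differentiableAt (by simp)
  -- a corestriction `φ : E4 → A.domain` of `Θ` on `S` (`Θ` maps the region into the chart domain)
  obtain ⟨φ, hφ⟩ : ∃ φ : E4 → A.domain, ∀ x ∈ S, (φ x : E4) = Θ x :=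
    ⟨fun x ↦ if hx : Θ x ∈ A.domain then ⟨Θ x, hx⟩ else ⟨Θ u, h⟩, fun x hx ↦ by
      dsimp only
      rw [dif_pos (show Θ x ∈ A.domain from hmaps (hSR hx))]⟩
  -- §1: chain rule and chart components of `g` along `A ∘ φ`
  have hmf : ∀ x ∈ S, ∀ v : E4, mfderiv 𝓘(ℝ, E4) (𝓡 4) (A.toFun ∘ φ) x v =
      mfderiv 𝓘(ℝ, E4) (𝓡 4) A.toFun (φ x) (fderiv ℝ Θ x v) := fun x hx v ↦
    mfderiv_adaptedChart_comp_apply A hSo hφ hx (hΘd x hx) v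
  have hcomp : ∀ x ∈ S, ∀ v w : E4,
      𝓑.toSpacetime.metricInCoords (A.toFun ∘ φ) x v w = Kerr.bilin M a x v w := by
    intro x hx v w
    rw [metricInCoords_adaptedChart_comp A hSo hφ hx (hΘd x hx)]
    exact hiso x hx v w
  -- §2: hypotheses of the orientation dichotomy
  have hΦs : ContMDiffOn 𝓘(ℝ, E4) (𝓡 4) ∞ (A.toFun ∘ φ) S := contMDiffOn_adaptedChart_comp A hSo hφ hΘS
  have hinj : ∀ y ∈ S, Function.Injective (mfderiv 𝓘(ℝ, E4) (𝓡 4) (A.toFun ∘ φ) y) := by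
    intro y hy v₁ v₂ hv
    rw [← sub_eq_zero]
    refine Kerr.bilin_nondegenerate M a (hrad y hy) (v₁ - v₂) fun w ↦ ?_
    rw [← hcomp y hy, Spacetime.metricInCoords_apply, map_sub, hv, sub_self, map_zero, zero_apply]
  have hpre : IsPreconnected S :=
    IsConnected.isPreconnected (Kerr.isConnected_region_holds a (Kerr.rPlus M a))
  have hY : ContinuousOn (Kerr.timeVector M a) S := fun x hx ↦
    (Kerr.contDiffAt_timeVector M a (hrad x hx) (n := 0)).continuousAt.continuousWithinAt
  have hneg : ∀ z ∈ S, 𝓑.toSpacetime.metricInCoords (A.toFun ∘ φ) z (Kerr.timeVector M a z)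
      (Kerr.timeVector M a z) < 0 := fun z hz ↦ by
    rw [hcomp z hz]
    exact Kerr.bilin_timeVector_timeVector_neg hM a (hrad z hz)
  -- §3: a base point `u₁` of the exterior charted into `M_ext`
  obtain ⟨m, hm⟩ := 𝓑.Mext_nonempty
  obtain ⟨w₁, hw₁⟩ := A.doc_subset_range (𝓑.Mext_subset_doc hm)
  have hw₁P : (w₁ : E4) ∈ Θ '' S := by
    rw [hanchor]
    refine ⟨w₁.2, ?_⟩
    rw [Subtype.coe_eta, hw₁]
    exact 𝓑.Mext_subset_doc hm
  obtain ⟨u₁, hu₁, hΘu₁⟩ := hw₁P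
  have hφu₁ : φ u₁ = w₁ := Subtype.ext (by rw [hφ u₁ hu₁]; exact hΘu₁)
  -- at the base point the pushed vector is future-directed
  have hbase : 𝓑.timeOrientation.IsFutureDirected
      (mfderiv 𝓘(ℝ, E4) (𝓡 4) (A.toFun ∘ φ) u₁ (Kerr.timeVector M a u₁)) := by
    -- `T = dA(e₀)` is future timelike at `A (φ u₁) = m ∈ M_ext`
    have hmem : A.toFun (φ u₁) ∈ 𝓑.Mext := by
      rw [hφu₁, hw₁]
      exact hm
    have hT := 𝓑.isStationaryKilling.isTimelike hmem
    rw [← A.mfderiv_toFun_basisVector (φ u₁)] at hT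
    -- `dΘ (e₀) = c e₀`, so `d(A ∘ φ)(c⁻¹ e₀) = dA(e₀) = T`
    have he₀ : fderiv ℝ Θ u₁ (E4.basisVector 0) = c • E4.basisVector 0 :=
      fderiv_apply_basisVector_zero_of_contDiffOn hRo (by simp) hΘs heqv (hSR hu₁)
    have hT'eq : mfderiv 𝓘(ℝ, E4) (𝓡 4) (A.toFun ∘ φ) u₁ (c⁻¹ • E4.basisVector 0) =
        mfderiv 𝓘(ℝ, E4) (𝓡 4) A.toFun (φ u₁) (E4.basisVector 0) := by
      rw [hmf u₁ hu₁, map_smul, he₀, smul_smul, inv_mul_cancel₀ hc.ne', one_smul]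
    -- `g(T, d(A ∘ φ) V) = c⁻¹ g_{M,a}(e₀, V) = -c⁻¹`
    have hval : 𝓑.metric.val ((A.toFun ∘ φ) u₁)
        (mfderiv 𝓘(ℝ, E4) (𝓡 4) A.toFun (φ u₁) (E4.basisVector 0))
        (mfderiv 𝓘(ℝ, E4) (𝓡 4) (A.toFun ∘ φ) u₁ (Kerr.timeVector M a u₁)) = -c⁻¹ := by
      have h1 := hcomp u₁ hu₁ (c⁻¹ • E4.basisVector 0) (Kerr.timeVector M a u₁)
      rw [Spacetime.metricInCoords_apply, hT'eq, map_smul, smul_apply,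
        Kerr.bilin_symm M a u₁ (E4.basisVector 0), Kerr.bilin_timeVector (hrad u₁ hu₁),
        smul_eq_mul] at h1
      refine h1.trans ?_
      simp [E4.basisVector]
    have hWc : 𝓑.metric.IsCausal (mfderiv 𝓘(ℝ, E4) (𝓡 4) (A.toFun ∘ φ) u₁ (Kerr.timeVector M a u₁)) :=
      (show 𝓑.metric.IsTimelike _ from hneg u₁ hu₁).isCausal
    exact 𝓑.timeOrientation.isFutureDirected_of_val_lt_zero hT.2 hT.1 hWc
      (hval.trans_lt (neg_lt_zero.2 (inv_pos.2 hc)))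
  -- §2: one orientation on the connected exterior
  rcases stub_futureDirected_dichotomy 𝓑.toSpacetime (A.toFun ∘ φ) S S (Kerr.timeVector M a) hSo hΦs
      hinj subset_rfl hpre hY hneg with hfut | hpast
  · -- transfer from `φ u` to the given `⟨Θ u, h⟩`
    have key : ∀ p : A.domain, p = φ u →
        𝓑.timeOrientation.IsFutureDirected
          (mfderiv 𝓘(ℝ, E4) (𝓡 4) A.toFun p (fderiv ℝ Θ u (Kerr.timeVector M a u))) := by
      rintro p rfl
      rw [← hmf u hu]
      exact hfut u hu
    exact key ⟨Θ u, h⟩ (Subtype.ext (hφ u hu).symm)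
  · have h2 := hpast u₁ hu₁
    have hmn : mfderiv 𝓘(ℝ, E4) (𝓡 4) (A.toFun ∘ φ) u₁ (-Kerr.timeVector M a u₁) =
        -(mfderiv 𝓘(ℝ, E4) (𝓡 4) (A.toFun ∘ φ) u₁ (Kerr.timeVector M a u₁)) :=
      (mfderiv 𝓘(ℝ, E4) (𝓡 4) (A.toFun ∘ φ) u₁).map_neg (Kerr.timeVector M a u₁)
    rw [hmn, TimeOrientation.isFutureDirected_neg_iff] at h2
    exact absurd h2 (𝓑.timeOrientation.not_isPastDirected_of_isFutureDirected hbase)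

end Summit.FinalStateConjecture.FinalStateConjecture.Theorems.SymplecticDualOfTheBomb

end
-- ===== END inlined copy of p135232 =====

-- ===== BEGIN inlined copy of p136225 (ChartTransferT2) =====
-- every `Summit.FinalStateConjecture.FinalStateConjecture.…` name repeats the summit = sub-problem segment (D-0017 layout)
set_option linter.dupNamespace false

noncomputable section

open scoped Manifold ContDiff Topology ENNReal
open Set Filter Function Literature.Geometry.Lorentzian

namespace Summit.FinalStateConjecture.FinalStateConjecture.Theorems.SymplecticDualOfTheBomb

open Summit.FinalStateConjecture.FinalStateConjecture.Theorems.OneLockedExplosion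

/-! ## §1 Past push-up for sets; monotonicity of the ray clause -/

section PushUp

variable {E : Type*} [NormedAddCommGroup E] [NormedSpace ℝ E] [FiniteDimensional ℝ E] {H : Type*}
  [TopologicalSpace H] {I : ModelWithCorners ℝ E H} {n : ℕ∞ω} {M : Type*} [TopologicalSpace M]
  [ChartedSpace H M] [IsManifold I ∞ M] [BoundarylessManifold I M] {g : LorentzianMetric I n M}
  {τ : TimeOrientation g}

/-- **Past push-up for sets**: `S ⊆ I⁻(U)` implies `J⁻(S) ⊆ I⁻(U)` (`x ≪ y ≤ z ⟹ x ≪ z` read for the reversed orientation,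
from `LorentzianMetric.mem_chronologicalFuture_of_mem_causalFuture` for `τ.reverse.reverse`), `n ≥ 1`. [cite: ONeill1983, Ch. 14, Cor. 14.1] -/
theorem causalPast_subset_chronologicalPast (hn : 1 ≤ n) {S U : Set M} (hS : S ⊆ g.chronologicalPast τ U) :
    g.causalPast τ S ⊆ g.chronologicalPast τ U := by
  rintro p (hp | ⟨q, hq, γ, a, b, hab, hγ, hγa, hγb⟩)
  · exact hS hp
  · obtain ⟨u, hu, β, a', b', hab', hβ, hβa, hβb⟩ := hS hq
    have hqp : q ∈ g.causalFuture τ.reverse.reverse {p} :=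
      Or.inr ⟨p, rfl, fun t ↦ γ (a + b - t), a, b, hab, hγ.reverseParam, by simp [hγb], by simp [hγa]⟩
    have hqu : u ∈ g.chronologicalFuture τ.reverse.reverse {q} :=
      LorentzianMetric.mem_chronologicalPast_of_mem_chronologicalFuture ⟨u, rfl, β, a', b', hab', hβ, hβa, hβb⟩
    exact LorentzianMetric.chronologicalFuture_mono (singleton_subset_iff.2 hu)
      (LorentzianMetric.mem_chronologicalFuture_of_mem_chronologicalPast
        (LorentzianMetric.mem_chronologicalFuture_of_mem_causalFuture hn hqp hqu))

end PushUp

section Rays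

variable {X : Type} [TopologicalSpace X] [ChartedSpace E3 X] [IsManifold (𝓡 3) ∞ X] [ConnectedSpace X]
  {D : InitialDataSet (𝓡 3) X}

/-- The summit's ray clause `RaysStayInClosure 𝒟 O` is monotone in `O` (`closure` is monotone). [folklore] -/
theorem raysStayInClosure_mono (𝒟 : CauchyDevelopment D) {A B : Set 𝒟.carrier} (hAB : A ⊆ B)
    (h : Summit.FinalStateConjecture.RaysStayInClosure 𝒟 A) : Summit.FinalStateConjecture.RaysStayInClosure 𝒟 B := by
  intro _ p γ dom hγ hdom t ht h0
  exact closure_mono hAB (h p γ dom hγ hdom t ht h0)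

/-! ## §2 The self-determined d.o.c. lies in the recut exterior -/

/-- **`O ∩ I⁻(docCharted d) ⊆ exteriorOf 𝒟 (recutCharted d M a Θ τ₁)`** for a stationary decomposition `d` of the honest
exterior, exhaustive in the d.o.c. sense, with Kerr identifications of tilt `≤ Lᵢ`, and a recut time `τ₁ ≥ τ₀` at which the
recut hole charts and the flat chart are late charts into `O` (module docstring, §2). [cite: DafermosLuk2017, Conjecture 1 (b)–(c)] -/
theorem inter_chronologicalPast_docCharted_subset_exteriorOf_recutCharted (𝒟 : CauchyDevelopment D)
    {O : Set 𝒟.carrier} {k : ℕ} (d : StationaryFinalStateDecomposition 𝒟.toSpacetime O k)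
    {M a c r₀ : Fin d.N → ℝ} {Θ : Fin d.N → E4 → E4} (hO : O = Summit.FinalStateConjecture.exteriorOf 𝒟 d.charted)
    (hex : HasExhaustiveDocCharts' d) (hK : ∀ i, IsKerrChartedWith (d.hole i) (d.adapted i) (M i) (a i) (c i) (r₀ i) (Θ i))
    (hmaps : ∀ i, MapsTo (recutMap (d.motion i).1 (d.motion i).2 (Θ i))
      ((recutBackground d M a i).domain : Set E4) ((d.background i).domain : Set E4))
    {L : Fin d.N → ℝ} (hL : ∀ i, ∀ u ∈ (Kerr.exterior (M i) (a i) : Set E4), |Θ i u 0 - c i * u 0| ≤ L i)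
    {τ₁ : ℝ} (hτ₀τ₁ : d.toOver.τ₀ ≤ τ₁)
    (hlate : ∀ i, 𝒟.toSpacetime.IsLateChart (recutBackground d M a i) O τ₁ (recutChart d M a Θ hmaps i))
    (hflat : 𝒟.toSpacetime.IsLateChart (Minkowski.backgroundOn d.toOver.flatDomain) O τ₁ d.toOver.flatChart) :
    O ∩ 𝒟.metric.chronologicalPast 𝒟.timeOrientation (docCharted d) ⊆
      Summit.FinalStateConjecture.exteriorOf 𝒟 (recutCharted d M a Θ τ₁) := by
  classical
  obtain ⟨R, -, -, -, -, hii⟩ := hex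
  rintro p ⟨hpO, hpI⟩
  refine ⟨by rw [hO] at hpO; exact hpO.1, ?_⟩
  -- points of `O` in an open piece of `recutCharted τ₁` are chronologically before it
  have hOI : ∀ q ∈ O, ∀ U : Set 𝒟.carrier, IsOpen U → q ∈ U → U ⊆ recutCharted d M a Θ τ₁ →
      q ∈ 𝒟.metric.chronologicalPast 𝒟.timeOrientation (recutCharted d M a Θ τ₁) := fun q hq U hU hqU hUsub ↦ by
    rw [hO] at hq
    exact LorentzianMetric.chronologicalFuture_mono hUsub (mem_chronologicalPast_of_isOpen hq.2 hU hqU)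
  -- a late enough chart time `τ`: beyond `T(p)`, `τ₁` and every `cᵢ τ₁ + Lᵢ`
  obtain ⟨T, hT₀, hT⟩ := exists_forall_not_mem_certifiedLate d.toOver R p
  obtain ⟨T', hT'⟩ := Finite.exists_le fun i ↦ c i * τ₁ + L i
  set τ : ℝ := max T (max T' τ₁) + 1 with hτ
  have hτT' : ∀ i, c i * τ₁ + L i < τ := fun i ↦ ((hT' i).trans ((le_max_left _ _).trans (le_max_right _ _))).trans_lt (lt_add_one _)
  have hττ₁ : τ₁ < τ := ((le_max_right _ _).trans (le_max_right _ _)).trans_lt (lt_add_one _)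
  have hττ₀ : d.toOver.τ₀ < τ := hτ₀τ₁.trans_lt hττ₁
  -- `p` is causally before the d.o.c.-certified slab at `τ`, which is chronologically before `recutCharted τ₁`
  have hpslab : p ∈ 𝒟.metric.causalPast 𝒟.timeOrientation (docCertifiedSlab d R τ) := hii τ hττ₀
    ⟨⟨hpO, hpI⟩, fun h ↦ hT τ ((le_max_left _ _).trans (lt_add_one _).le) (docCertifiedLate_subset_certifiedLate d R τ h)⟩
  refine causalPast_subset_chronologicalPast (by exact_mod_cast le_top) (fun q hq ↦ ?_) hpslab
  rcases hq with ⟨y, hy, rfl⟩ | hq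
  · -- a flat slab point of time `τ > τ₁`
    have hy' : (y : E4) 0 = τ := hy
    have hy₁ : y ∈ (Minkowski.backgroundOn d.toOver.flatDomain).lateRegion τ₁ := by show τ₁ < (y : E4) 0; rw [hy']; exact hττ₁
    refine hOI _ (hflat.image_subset ⟨y, hy₁, rfl⟩) _ (isOpen_image_of_isLateChart hflat) ⟨y, hy₁, rfl⟩ ?_
    rw [recutCharted_eq d M a Θ hmaps]
    exact subset_union_left
  · -- a d.o.c. hole slab point `ψᵢ x`, `P⁻¹ x = Θᵢ u`: the recut chart point of `z = P u`, Kerr–Schild time `u⁰ > τ₁`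
    obtain ⟨i, hi⟩ := mem_iUnion.1 hq
    obtain ⟨x, ⟨hxs, hxd⟩, rfl⟩ := hi
    obtain ⟨u, hu, hux⟩ : poincareInv (d.motion i).1 (d.motion i).2 x.1 ∈ Θ i '' (Kerr.exterior (M i) (a i) : Set E4) := by
      rw [(hK i).2.2.2.2.2.2.2.2.2.1]; exact hxd
    have hx0 : (poincareInv (d.motion i).1 (d.motion i).2 x.1) 0 = τ := hxs.1
    have hu0 : τ₁ < u 0 := by
      have h1 := (abs_le.1 (hL i u hu)).2
      rw [hux, hx0] at h1
      have h2 : c i * τ₁ < c i * u 0 := by linarith [hτT' i]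
      exact lt_of_mul_lt_mul_left h2 (hK i).2.1.le
    set z : E4 := ((d.motion i).1 : E4 ≃L[ℝ] E4) u + (d.motion i).2 with hz_def
    have hz : z ∈ ((recutBackground d M a i).domain : Set E4) := by
      show poincareInv (d.motion i).1 (d.motion i).2 z ∈ (Kerr.exterior (M i) (a i) : Set E4)
      rw [hz_def, poincareInv_apply_add]; exact hu
    have hzlate : (⟨z, hz⟩ : (recutBackground d M a i).domain) ∈ (recutBackground d M a i).lateRegion τ₁ := by
      show τ₁ < (poincareInv (d.motion i).1 (d.motion i).2 z) 0
      rw [hz_def, poincareInv_apply_add]; exact hu0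
    have hqeq : recutChart d M a Θ hmaps i ⟨z, hz⟩ = d.toOver.chart i x := by
      show d.toOver.chart i _ = d.toOver.chart i x
      congr 1; apply Subtype.ext
      show ((d.motion i).1 : E4 ≃L[ℝ] E4) (Θ i (poincareInv (d.motion i).1 (d.motion i).2 z)) + (d.motion i).2 = x.1
      rw [hz_def, poincareInv_apply_add, hux, apply_poincareInv_add]
    have hxlate : x ∈ (d.background i).lateRegion d.toOver.τ₀ := by
      show d.toOver.τ₀ < (poincareInv (d.motion i).1 (d.motion i).2 x.1) 0
      rw [hx0]; exact hττ₀
    refine hOI _ ((d.toOver.isLateChart i).image_subset ⟨x, hxlate, rfl⟩) _ (isOpen_image_of_isLateChart (hlate i))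
      ⟨⟨z, hz⟩, hzlate, hqeq⟩ ?_
    rw [recutCharted_eq d M a Θ hmaps]
    exact subset_union_of_subset_right
      (subset_iUnion (fun j ↦ recutChart d M a Θ hmaps j '' (recutBackground d M a j).lateRegion τ₁) i) _

end Rays

/-! ## §3 Eventual timelikeness of the inspected push-forwards from the `C⁰` convergence -/

section Timelike

variable (𝓢 : Spacetime.{0} 4)

/-- **`C⁰`-closeness controls the pulled-back metric pointwise**: if the `Cᵏ` deviation of `ψ^* g` from `g₀` on the truncated
slab `{t = τ, r ≤ R}` is `< ε`, then at every `x` of the slab, `g(dψ w, dψ w) ≤ g₀(x)(w, w) + ε ‖w‖²`. [folklore] -/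
theorem val_mfderiv_le_of_truncDeviationCk_lt (B : ModelBackground) (ψ : B.domain → 𝓢.carrier) {k : ℕ} {R τ ε : ℝ}
    (hε : 0 < ε) (h : 𝓢.truncDeviationCk B ψ k R τ < ENNReal.ofReal ε) {x : B.domain} (hx : x ∈ B.truncTimeSlab R τ)
    (w : E4) : 𝓢.metric.val (ψ x) (mfderiv 𝓘(ℝ, E4) (𝓡 4) ψ x w) (mfderiv 𝓘(ℝ, E4) (𝓡 4) ψ x w) ≤
      B.bilin x.1 w w + ε * (‖w‖ * ‖w‖) := by
  have h1 : ‖𝓢.deviation B ψ x‖ < ε := by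
    have h2 := enorm_iteratedFDeriv_le_supCkENorm (Nat.zero_le k) (mem_image_of_mem Subtype.val hx) (𝓢.deviationExtend B ψ)
    rw [← ofReal_norm, norm_iteratedFDeriv_zero, 𝓢.deviationExtend_coe] at h2
    exact (ENNReal.ofReal_lt_ofReal_iff hε).1 (h2.trans_lt h)
  have h3 : |𝓢.deviation B ψ x w w| ≤ ‖𝓢.deviation B ψ x‖ * ‖w‖ * ‖w‖ := by
    rw [← Real.norm_eq_abs]; exact (𝓢.deviation B ψ x).le_opNorm₂ w w
  have h4 := 𝓢.deviation_apply B ψ x w w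
  have h6 : ‖𝓢.deviation B ψ x‖ * ‖w‖ * ‖w‖ ≤ ε * (‖w‖ * ‖w‖) := by
    rw [mul_assoc]; exact mul_le_mul_of_nonneg_right h1.le (mul_nonneg (norm_nonneg w) (norm_nonneg w))
  linarith [(abs_le.1 h3).2]

/-- **Flat slabs: `dΨ₀(∂₀)` is eventually timelike** when the `Cᵏ` deviation of `Ψ₀^* g` from `η` tends to `0`. [folklore] -/
theorem eventually_isTimelike_flat {U : TopologicalSpace.Opens E4} (ψ : (Minkowski.backgroundOn U).domain → 𝓢.carrier)
    {k : ℕ} (h : Tendsto (fun τ ↦ 𝓢.deviationCk (Minkowski.backgroundOn U) ψ k τ) atTop (𝓝 0)) :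
    ∀ᶠ τ in atTop, ∀ y ∈ (Minkowski.backgroundOn U).timeSlab τ,
      𝓢.metric.IsTimelike (mfderiv 𝓘(ℝ, E4) (𝓡 4) ψ y (E4.basisVector 0)) := by
  have hε : (0 : ℝ) < 1 / 2 := by norm_num
  filter_upwards [h.eventually (gt_mem_nhds (ENNReal.ofReal_pos.2 hε))] with τ hτ y hy
  have hy' : y ∈ (Minkowski.backgroundOn U).truncTimeSlab ((Minkowski.backgroundOn U).radius y.1) τ := ⟨hy, le_rfl⟩
  have h2 := val_mfderiv_le_of_truncDeviationCk_lt 𝓢 (Minkowski.backgroundOn U) ψ hε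
    ((𝓢.truncDeviationCk_le_deviationCk (Minkowski.backgroundOn U) ψ k _ τ).trans_lt hτ) hy' (E4.basisVector 0)
  have h3 : (Minkowski.backgroundOn U).bilin y.1 (E4.basisVector 0) (E4.basisVector 0) = -1 :=
    Minkowski.bilin_basisVector_zero
  have h4 : ‖E4.basisVector 0‖ = 1 := by simp [E4.basisVector]
  rw [h3, h4] at h2
  exact h2.trans_lt (by norm_num)

/-- `‖V_{M,a}(u)‖ ≤ 5` on the sub-extremal Kerr exterior: `V = ∂₀ − 2H ℓ♯`, `0 ≤ H ≤ 1` (`Kerr.scalarH_le_one`), `‖ℓ♯‖² = 2`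
(`Kerr.norm_nullVector_sq`). Dafermos–Rodnianski arXiv:0811.0354, §5.1. [folklore] -/
theorem norm_timeVector_le {M a : ℝ} (hMa : Kerr.IsSubextremal M a) {u : E4} (hu : u ∈ (Kerr.exterior M a : Set E4)) :
    ‖Kerr.timeVector M a u‖ ≤ 5 := by
  have hr : 0 < Kerr.radius a u := Kerr.radius_pos_of_mem_region hu
  have hH0 : 0 ≤ Kerr.scalarH M a u := Kerr.scalarH_nonneg hMa.pos.le a u
  have hH1 : Kerr.scalarH M a u ≤ 1 := Kerr.scalarH_le_one hMa hu
  have hℓ : ‖Kerr.nullVector a u‖ ≤ 2 := by nlinarith [Kerr.norm_nullVector_sq hr (a := a), norm_nonneg (Kerr.nullVector a u)]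
  have h4 : ‖E4.basisVector 0‖ = 1 := by simp [E4.basisVector]
  calc ‖Kerr.timeVector M a u‖ ≤ ‖E4.basisVector 0‖ + ‖(2 * Kerr.scalarH M a u) • Kerr.nullVector a u‖ := norm_sub_le _ _
    _ = 1 + 2 * Kerr.scalarH M a u * ‖Kerr.nullVector a u‖ := by
        rw [h4, norm_smul, Real.norm_eq_abs, abs_of_nonneg (by linarith)]
    _ ≤ 5 := by nlinarith

/-- **Boosted Kerr–Schild slabs: the push-forward of `Λ V_{M,a}` is eventually timelike** when the `Cᵏ` deviation of `ψ^* g`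
from boosted Kerr (`|a| < M`) on the truncated slabs tends to `0`: `g_{M,a}(V, V) = −1 − 2H ≤ −1`, `‖Λ V‖ ≤ 5‖Λ‖`. [folklore] -/
theorem eventually_isTimelike_boostedKerr {Λ : lorentzGroup} {c₀ : E4} {M a : ℝ} (hMa : Kerr.IsSubextremal M a)
    (ψ : (boostedKerrBackground Λ c₀ M a).domain → 𝓢.carrier) {k : ℕ} (ρ : ℝ)
    (h : Tendsto (fun τ ↦ 𝓢.truncDeviationCk (boostedKerrBackground Λ c₀ M a) ψ k ρ τ) atTop (𝓝 0)) :
    ∀ᶠ τ in atTop, ∀ x ∈ (boostedKerrBackground Λ c₀ M a).truncTimeSlab ρ τ, 𝓢.metric.IsTimelike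
      (mfderiv 𝓘(ℝ, E4) (𝓡 4) ψ x ((Λ : E4 ≃L[ℝ] E4) (Kerr.timeVector M a (poincareInv Λ c₀ x.1)))) := by
  set K : ℝ := ‖((Λ : E4 ≃L[ℝ] E4) : E4 →L[ℝ] E4)‖ with hK
  have hK0 : 0 ≤ K := norm_nonneg _
  set ε : ℝ := 1 / ((5 * K) ^ 2 + 1) with hε_def
  have hε : 0 < ε := by positivity
  have hε1 : ε * ((5 * K) ^ 2) < 1 := by
    rw [hε_def, div_mul_eq_mul_div, one_mul, div_lt_one (by positivity)]; linarith
  filter_upwards [h.eventually (gt_mem_nhds (ENNReal.ofReal_pos.2 hε))] with τ hτ x hx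
  have hu : poincareInv Λ c₀ x.1 ∈ (Kerr.exterior M a : Set E4) := mem_boostedKerrExterior.1 x.2
  have hr : 0 < Kerr.radius a (poincareInv Λ c₀ x.1) := Kerr.radius_pos_of_mem_region hu
  have hV := norm_timeVector_le hMa hu
  have hw : ‖(Λ : E4 ≃L[ℝ] E4) (Kerr.timeVector M a (poincareInv Λ c₀ x.1))‖ ≤ 5 * K := by
    have h1 := ((Λ : E4 ≃L[ℝ] E4) : E4 →L[ℝ] E4).le_opNorm (Kerr.timeVector M a (poincareInv Λ c₀ x.1))
    rw [ContinuousLinearEquiv.coe_coe] at h1; nlinarith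
  have h2 := val_mfderiv_le_of_truncDeviationCk_lt 𝓢 (boostedKerrBackground Λ c₀ M a) ψ hε hτ hx
    ((Λ : E4 ≃L[ℝ] E4) (Kerr.timeVector M a (poincareInv Λ c₀ x.1)))
  have h3 : (boostedKerrBackground Λ c₀ M a).bilin x.1 ((Λ : E4 ≃L[ℝ] E4) (Kerr.timeVector M a (poincareInv Λ c₀ x.1)))
      ((Λ : E4 ≃L[ℝ] E4) (Kerr.timeVector M a (poincareInv Λ c₀ x.1))) = -1 - 2 * Kerr.scalarH M a (poincareInv Λ c₀ x.1) := by
    show boostedKerrBilin Λ c₀ M a x.1 _ _ = _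
    rw [boostedKerrBilin_apply, ContinuousLinearEquiv.symm_apply_apply, Kerr.bilin_timeVector_timeVector hr]
  rw [h3] at h2
  have h4 : ε * (‖(Λ : E4 ≃L[ℝ] E4) (Kerr.timeVector M a (poincareInv Λ c₀ x.1))‖ *
      ‖(Λ : E4 ≃L[ℝ] E4) (Kerr.timeVector M a (poincareInv Λ c₀ x.1))‖) ≤ ε * ((5 * K) ^ 2) :=
    mul_le_mul_of_nonneg_left (by nlinarith [norm_nonneg ((Λ : E4 ≃L[ℝ] E4) (Kerr.timeVector M a (poincareInv Λ c₀ x.1)))]) hε.le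
  exact h2.trans_lt (by linarith [Kerr.scalarH_nonneg hMa.pos.le a (poincareInv Λ c₀ x.1)])

end Timelike

/-! ## §4 The stub, unfolded: `chartTransferT2_unfolded` -/

/-- **Stub `stub_chartTransferT2` of line `SketchIdeator1` (crux stmt-FinalStateConjecture-17839) = `Sig7.stub_chartTransferT2`
UNFOLDED** (`IsOrientationCompatible 𝒟 d` replaced by its body): the chart transfer in general position with the RE-TYPED
summit's per-datum conclusion. `d'` is the recut decomposition of `stub_chartTransferGeneral` (proof re-run: late time `τ₁`,
honest radii); the ray clause transfers along `O ∩ I⁻(docCharted d) ⊆ O'` (§2, `raysStayInClosure_mono`); `IsFutureOriented d'`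
by orthochronous motions, the orientation clauses of `d`, future-preservation of the `Θᵢ`, and §3 (chain rule
`d(ψᵢ ∘ recutMap Θᵢ)(Λ V) = dψᵢ(Λ dΘᵢ V)` by `mfderiv_readapt`, `fderiv_conj`). [cite: DafermosLuk2017, Conjecture 1 (b)–(c)] -/
theorem chartTransferT2_unfolded : ∀ (X : Type) [TopologicalSpace X] [ChartedSpace E3 X] [IsManifold (𝓡 3) ∞ X] [T2Space X] [SecondCountableTopology X] [ConnectedSpace X] (D : InitialDataSet (𝓡 3) X) (𝒟 : VacuumCauchyDevelopment D) (O : Set 𝒟.carrier) (d : StationaryFinalStateDecomposition 𝒟.toSpacetime O 2) (M a c r₀ : Fin d.N → ℝ) (Θ : Fin d.N → E4 → E4), O = Summit.FinalStateConjecture.exteriorOf 𝒟.toCauchyDevelopment d.charted → HasExhaustiveDocCharts' d → IsHorizonNormalised d → (∀ i, IsKerrChartedWith (d.hole i) (d.adapted i) (M i) (a i) (c i) (r₀ i) (Θ i)) → (∀ i, ∀ u ∈ (Kerr.exterior (M i) (a i) : Set E4), ∀ h : Θ i u ∈ (d.adapted i).domain, (d.hole i).timeOrientation.IsFutureDirected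 (mfderiv 𝓘(ℝ, E4) (𝓡 4) (d.adapted i).toFun ⟨Θ i u, h⟩ (fderiv ℝ (Θ i) u (Kerr.timeVector (M i) (a i) u)))) → KerrSchildRecutCovering 𝒟 d M a Θ → Summit.FinalStateConjecture.RaysStayInClosure 𝒟.toCauchyDevelopment (O ∩ 𝒟.metric.chronologicalPast 𝒟.timeOrientation (docCharted d)) → ((∀ i, Summit.FinalStateConjecture.IsOrthochronous (d.motion i).1) ∧ (∀ (i : Fin d.N) (y : (d.background i).domain) (w : E4), d.toOver.τ₀ < (d.background i).time y.1 → (d.hole i).timeOrientation.IsFutureDirected (mfderiv 𝓘(ℝ, E4) (𝓡 4) (d.adapted i).toFun ⟨poincareInv (d.motion i).1 (d.motion i).2 y.1, ModelBackground.mem_boost_domain.1 y.2⟩ (((d.motion i).1 : E4 ≃L[ℝ] E4).symm w)) → 𝒟.metric.IsTimelike (mfderiv 𝓘(ℝ, E4) (𝓡 4) (d.toOver.chart i) y w) → 𝒟.timeOrientation.IsFutureDirected (mfderiv 𝓘(ℝ, E4) (𝓡 4) (d.toOver.chart i) y w)) ∧ ∀ y : d.toOver.flatDomain, d.toOver.τ₀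 < (y : E4) 0 → 𝒟.metric.IsTimelike (mfderiv 𝓘(ℝ, E4) (𝓡 4) d.toOver.flatChart y (E4.basisVector 0)) → 𝒟.timeOrientation.IsFutureDirected (mfderiv 𝓘(ℝ, E4) (𝓡 4) d.toOver.flatChart y (E4.basisVector 0))) → ∃ (O' : Set 𝒟.carrier) (d' : FinalStateDecomposition 𝒟.toSpacetime O' 2), (∀ i, Kerr.IsSubextremal (d'.mass i) (d'.spin i)) ∧ O' = Summit.FinalStateConjecture.exteriorOf 𝒟.toCauchyDevelopment d'.charted ∧ Summit.FinalStateConjecture.RaysStayInClosure 𝒟.toCauchyDevelopment O' ∧ Summit.FinalStateConjecture.HasExhaustiveCharts d' ∧ Summit.FinalStateConjecture.IsFutureOriented d' := by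
  intro X _ _ _ _ _ _ D 𝒟 O d M a c r₀ Θ hO hex _ hK hF5 hG hrays horient
  -- the clauses of `IsKerrChartedWith`
  have hsub := fun i ↦ (hK i).1
  have hc := fun i ↦ (hK i).2.1
  have hr₀ := fun i ↦ (hK i).2.2.2.1
  have hΘs := fun i ↦ (hK i).2.2.2.2.1
  have hinj := fun i ↦ (hK i).2.2.2.2.2.1
  have hΘm := fun i ↦ (hK i).2.2.2.2.2.2.1
  have hΘe := fun i ↦ (hK i).2.2.2.2.2.2.2.1
  have hiso := fun i ↦ (hK i).2.2.2.2.2.2.2.2.1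
  have hsubreg : ∀ i, (Kerr.exterior (M i) (a i) : Set E4) ⊆ (Kerr.region (a i) (r₀ i) : Set E4) :=
    fun i z hz ↦ Kerr.mem_region.2 ((max_le_max (hr₀ i).le le_rfl).trans_lt (Kerr.mem_exterior.1 hz))
  -- the recut maps carry the boosted exteriors into the moved adapted domains
  have hmaps : ∀ i, MapsTo (recutMap (d.motion i).1 (d.motion i).2 (Θ i))
      ((recutBackground d M a i).domain : Set E4) ((d.background i).domain : Set E4) := fun i x hx ↦
    mapsTo_conj (d.motion i).1 (d.motion i).2 (hΘm i) (hsubreg i (mem_boostedKerrExterior.1 hx))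
  obtain ⟨τ₀', R', hτ₀', hR', hconv, -, hii⟩ := hG hmaps
  -- tilt bounds and the new late time `τ₁`
  choose L hL using fun i ↦ kerrChartedWith_tilt_bound _ _ _ _ _ _ _ (hK i)
  obtain ⟨T, hT⟩ := Finite.exists_le fun i ↦ (d.toOver.τ₀ + L i) / c i
  obtain ⟨τ₁, hτ₀'τ₁, hTτ₁⟩ : ∃ τ₁ : ℝ, τ₀' < τ₁ ∧ T ≤ τ₁ := ⟨max (τ₀' + 1) T, (lt_add_one _).trans_le (le_max_left _ _), le_max_right _ _⟩
  have hτ₀τ₁ : d.toOver.τ₀ ≤ τ₁ := hτ₀'.trans hτ₀'τ₁.le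
  have htilt : ∀ i, ∀ u ∈ (Kerr.exterior (M i) (a i) : Set E4), τ₁ < u 0 → d.toOver.τ₀ < Θ i u 0 := by
    intro i u hu hu0
    have h2 : (d.toOver.τ₀ + L i) / c i ≤ τ₁ := (hT i).trans hTτ₁
    rw [div_le_iff₀ (hc i)] at h2
    nlinarith [mul_lt_mul_of_pos_left hu0 (hc i), (abs_le.1 (hL i u hu)).1]
  -- the hole charts: late charts into `O`, then into `O'`
  have himgO : ∀ i, recutChart d M a Θ hmaps i '' (recutBackground d M a i).lateRegion τ₁ ⊆ O := by
    rintro i _ ⟨y, hy, rfl⟩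
    refine (d.toOver.isLateChart i).image_subset ⟨⟨_, hmaps i y.2⟩, ?_, rfl⟩
    show d.toOver.τ₀ < (poincareInv (d.motion i).1 (d.motion i).2
      (((d.motion i).1 : E4 ≃L[ℝ] E4) (Θ i (poincareInv (d.motion i).1 (d.motion i).2 y.1)) + (d.motion i).2)) 0
    rw [poincareInv_apply_add]; exact htilt i _ (mem_boostedKerrExterior.1 y.2) hy
  have hlateO : ∀ i, 𝒟.toSpacetime.IsLateChart (recutBackground d M a i) O τ₁ (recutChart d M a Θ hmaps i) :=
    fun i ↦ isLateChart_recut (d.adapted i) (d.motion i).1 (d.motion i).2 (d.toOver.isLateChart i)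
      (hr₀ i).le (hΘs i) (hinj i) (hiso i) (hmaps i) (htilt i) (himgO i)
  have hlate : ∀ i, 𝒟.toSpacetime.IsLateChart (recutBackground d M a i)
      (Summit.FinalStateConjecture.exteriorOf 𝒟.toCauchyDevelopment (recutCharted d M a Θ τ₁)) τ₁
      (recutChart d M a Θ hmaps i) := fun i ↦
    ⟨(hlateO i).contMDiff, (hlateO i).isOpenEmbedding,
      subset_exteriorOf_of_isOpen _ ((himgO i).trans hO.subset) (isOpen_image_of_isLateChart (hlateO i)) (by
        rw [recutCharted_eq d M a Θ hmaps]
        exact subset_union_of_subset_right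
          (subset_iUnion (fun i ↦ recutChart d M a Θ hmaps i '' (recutBackground d M a i).lateRegion τ₁) i) _)⟩
  -- the flat chart, re-based at `τ₁`
  have hflatimg : d.toOver.flatChart '' (Minkowski.backgroundOn d.toOver.flatDomain).lateRegion τ₁ ⊆ O :=
    (image_mono ((Minkowski.backgroundOn d.toOver.flatDomain).lateRegion_mono hτ₀τ₁)).trans
      d.toOver.isLateChart_flat.image_subset
  have hflatO : 𝒟.toSpacetime.IsLateChart (Minkowski.backgroundOn d.toOver.flatDomain) O τ₁ d.toOver.flatChart :=
    isLateChart_rebase _ d.toOver.isLateChart_flat hτ₀τ₁ (isOpen_lateRegion_backgroundOn _ _) hflatimg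
  have hflat : 𝒟.toSpacetime.IsLateChart (Minkowski.backgroundOn d.toOver.flatDomain)
      (Summit.FinalStateConjecture.exteriorOf 𝒟.toCauchyDevelopment (recutCharted d M a Θ τ₁)) τ₁ d.toOver.flatChart :=
    ⟨hflatO.contMDiff, hflatO.isOpenEmbedding, subset_exteriorOf_of_isOpen _ (hflatimg.trans hO.subset)
      (isOpen_image_of_isLateChart hflatO) subset_union_left⟩
  -- near-zone convergence for every radius, separation, excision
  have hconv' : ∀ i (R : ℝ), Tendsto (fun τ ↦ 𝒟.toSpacetime.truncDeviationCk (recutBackground d M a i)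
      (recutChart d M a Θ hmaps i) 2 R τ) atTop (𝓝 0) := fun i ↦ tendsto_truncDeviationCk_of_tendsto_atTop _ _ _ (hR' i) (hconv i)
  have hsep := separation_recut d M a c r₀ Θ hmaps hsub hc hr₀ (fun i ↦ (hΘs i).continuousOn) hΘm hΘe
  obtain ⟨ρ, hρ, hρdom⟩ := excision_transfer 𝒟.toSpacetime O 2 d a
  -- the covering clause at `τ₁` (`hcov` below) and exhaustiveness (ii) come from (ii) of the covering
  have hanti := exteriorOf_mono 𝒟.toCauchyDevelopment (recutCharted_anti d M a Θ hτ₀'τ₁.le)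
  -- honest radii: raise the growing radii `R'` of the covering to at least `max (r₊, 0) + 1`
  set R'' : Fin d.N → ℝ → ℝ := fun i τ ↦ max (R' i τ) (max (Kerr.rPlus (M i) (a i)) 0 + 1) with hR''
  have hR'le : ∀ i τ, R' i τ ≤ R'' i τ := fun i τ ↦ le_max_left _ _
  have hconv'' : ∀ i, Tendsto (fun τ ↦ 𝒟.toSpacetime.truncDeviationCk (recutBackground d M a i)
      (recutChart d M a Θ hmaps i) 2 (R'' i τ) τ) atTop (𝓝 0) := by
    refine fun i ↦ (hconv i).congr' ?_
    filter_upwards [(hR' i).eventually_ge_atTop (max (Kerr.rPlus (M i) (a i)) 0 + 1)] with τ hτ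
    simp only [hR'', max_eq_left hτ]; rfl
  have hlate_mono : ∀ τ₂, recutCertifiedLate d M a Θ R' τ₂ ⊆ recutCertifiedLate d M a Θ R'' τ₂ :=
    fun τ₂ ↦ union_subset_union le_rfl (iUnion_mono fun i ↦ recutImage_mono d Θ i
      (image_mono fun x hx ↦ ⟨hx.1, hx.2.trans (hR'le i _)⟩))
  have hslab_mono : ∀ τ₂, recutCertifiedSlab d M a Θ R' τ₂ ⊆ recutCertifiedSlab d M a Θ R'' τ₂ :=
    fun τ₂ ↦ union_subset_union le_rfl (iUnion_mono fun i ↦ recutImage_mono d Θ i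
      (image_mono ((recutBackground d M a i).truncTimeSlab_mono (hR'le i τ₂) τ₂)))
  refine ⟨_, recutDecomposition d M a Θ hmaps τ₁ (fun i ↦ (hsub i).pos) (fun i ↦ (hsub i).le) hlate hconv' hsep ρ hρ
    (hρdom τ₁ hτ₀τ₁) hflat (fun p hp ↦ LorentzianMetric.causalFuture_mono (recutCertifiedSlab_subset d M a Θ hmaps R' τ₁)
      (hii τ₁ hτ₀'τ₁ ⟨hanti hp.1, fun h ↦ hp.2 (recutCertifiedLate_subset d M a Θ hmaps R' τ₁ h)⟩)), hsub, ?_, ?_,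
    ⟨R'', fun i ↦ ⟨tendsto_atTop_mono (hR'le i) (hR' i), fun τ ↦ le_max_right _ _⟩, hconv'', fun τ₂ hτ₂ ↦ ?_⟩, horient.1,
    fun i ρ' ↦ ?_, ?_⟩
  · rw [charted_recutDecomposition]
  · -- the ray clause: `O ∩ I⁻(docCharted d) ⊆ O'`
    exact raysStayInClosure_mono 𝒟.toCauchyDevelopment (inter_chronologicalPast_docCharted_subset_exteriorOf_recutCharted
      𝒟.toCauchyDevelopment d hO hex hK hmaps hL hτ₀τ₁ hlateO hflatO) hrays
  · rw [certifiedLate_recutDecomposition, certifiedSlab_recutDecomposition]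
    exact fun p hp ↦ LorentzianMetric.causalFuture_mono (hslab_mono τ₂)
      (hii τ₂ (hτ₀'τ₁.trans hτ₂) ⟨hanti hp.1, fun h ↦ hp.2 (hlate_mono τ₂ h)⟩)
  · -- (ii) the push-forwards of `Λᵢ V_{Mᵢ,aᵢ}` by the recut hole charts are eventually future-directed
    show ∀ᶠ τ in atTop, ∀ x ∈ (recutBackground d M a i).truncTimeSlab ρ' τ,
      𝒟.timeOrientation.IsFutureDirected (mfderiv 𝓘(ℝ, E4) (𝓡 4) (recutChart d M a Θ hmaps i) x
        (((d.motion i).1 : E4 ≃L[ℝ] E4) (Kerr.timeVector (M i) (a i) (poincareInv (d.motion i).1 (d.motion i).2 x.1))))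
    have hΘd : ∀ u ∈ (Kerr.exterior (M i) (a i) : Set E4), DifferentiableAt ℝ (Θ i) u := fun u hu ↦
      ((hΘs i).differentiableOn (by simp)).differentiableAt ((Kerr.region _ _).isOpen.mem_nhds (hsubreg i hu))
    have hΦ : ContDiffOn ℝ ∞ (recutMap (d.motion i).1 (d.motion i).2 (Θ i)) ((recutBackground d M a i).domain : Set E4) :=
      (contDiffOn_conj (d.motion i).1 (d.motion i).2 (hΘs i)).mono fun z hz ↦ hsubreg i (mem_boostedKerrExterior.1 hz)
    -- chain rule: `d(ψᵢ ∘ recutMap Θᵢ)_x v = dψᵢ (Λ (dΘᵢ (Λ⁻¹ v)))`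
    have hchain : ∀ (x : (recutBackground d M a i).domain) (v : E4),
        mfderiv 𝓘(ℝ, E4) (𝓡 4) (recutChart d M a Θ hmaps i) x v =
          mfderiv 𝓘(ℝ, E4) (𝓡 4) (d.toOver.chart i) ⟨recutMap (d.motion i).1 (d.motion i).2 (Θ i) x.1, hmaps i x.2⟩
            (((d.motion i).1 : E4 ≃L[ℝ] E4) (fderiv ℝ (Θ i) (poincareInv (d.motion i).1 (d.motion i).2 x.1)
              (((d.motion i).1 : E4 ≃L[ℝ] E4).symm v))) := by
      intro x v
      have hd : mfderiv 𝓘(ℝ, E4) (𝓡 4) (recutChart d M a Θ hmaps i) x =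
          (mfderiv 𝓘(ℝ, E4) (𝓡 4) (d.toOver.chart i) ⟨recutMap (d.motion i).1 (d.motion i).2 (Θ i) x.1, hmaps i x.2⟩).comp
            (mfderiv 𝓘(ℝ, E4) 𝓘(ℝ, E4) (fun y : (recutBackground d M a i).domain ↦
              (⟨recutMap (d.motion i).1 (d.motion i).2 (Θ i) y.1, hmaps i y.2⟩ : (d.background i).domain)) x) :=
        mfderiv_comp x ((d.toOver.isLateChart i).contMDiff.mdifferentiableAt (by simp))
          ((contMDiff_readapt (hmaps i) hΦ).mdifferentiableAt (by simp))
      rw [hd, mfderiv_readapt (hmaps i) hΦ x]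
      show mfderiv 𝓘(ℝ, E4) (𝓡 4) (d.toOver.chart i) ⟨_, hmaps i x.2⟩ (fderiv ℝ (fun x ↦ ((d.motion i).1 : E4 ≃L[ℝ] E4)
        (Θ i (poincareInv (d.motion i).1 (d.motion i).2 x)) + (d.motion i).2) x.1 v) = _
      rw [fderiv_conj _ _ (hΘd _ (mem_boostedKerrExterior.1 x.2))]; rfl
    filter_upwards [eventually_isTimelike_boostedKerr 𝒟.toSpacetime (hsub i) (recutChart d M a Θ hmaps i) ρ' (hconv' i ρ'),
      eventually_gt_atTop τ₁] with τ hτ hττ₁ x hx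
    have hu : poincareInv (d.motion i).1 (d.motion i).2 x.1 ∈ (Kerr.exterior (M i) (a i) : Set E4) :=
      mem_boostedKerrExterior.1 x.2
    have hx0 : (poincareInv (d.motion i).1 (d.motion i).2 x.1) 0 = τ := hx.1
    have hmem : Θ i (poincareInv (d.motion i).1 (d.motion i).2 x.1) ∈ (d.adapted i).domain := hΘm i (hsubreg i hu)
    have htime : d.toOver.τ₀ < (d.background i).time (recutMap (d.motion i).1 (d.motion i).2 (Θ i) x.1) := by
      show d.toOver.τ₀ < (poincareInv (d.motion i).1 (d.motion i).2 (((d.motion i).1 : E4 ≃L[ℝ] E4)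
        (Θ i (poincareInv (d.motion i).1 (d.motion i).2 x.1)) + (d.motion i).2)) 0
      rw [poincareInv_apply_add]; exact htilt i _ hu (by rw [hx0]; exact hττ₁)
    have key : ∀ p : (d.adapted i).domain, p = ⟨Θ i (poincareInv (d.motion i).1 (d.motion i).2 x.1), hmem⟩ →
        (d.hole i).timeOrientation.IsFutureDirected (mfderiv 𝓘(ℝ, E4) (𝓡 4) (d.adapted i).toFun p (fderiv ℝ (Θ i)
          (poincareInv (d.motion i).1 (d.motion i).2 x.1) (Kerr.timeVector (M i) (a i) (poincareInv (d.motion i).1 (d.motion i).2 x.1)))) := by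
      rintro p rfl; exact hF5 i _ hu hmem
    have hTL : 𝒟.metric.IsTimelike (mfderiv 𝓘(ℝ, E4) (𝓡 4) (recutChart d M a Θ hmaps i) x
        (((d.motion i).1 : E4 ≃L[ℝ] E4) (Kerr.timeVector (M i) (a i) (poincareInv (d.motion i).1 (d.motion i).2 x.1)))) :=
      hτ x hx
    rw [hchain, ContinuousLinearEquiv.symm_apply_apply] at hTL
    have h := horient.2.1 i ⟨recutMap (d.motion i).1 (d.motion i).2 (Θ i) x.1, hmaps i x.2⟩ _ htime ?_ hTL
    · rw [hchain, ContinuousLinearEquiv.symm_apply_apply]; exact h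
    · rw [ContinuousLinearEquiv.symm_apply_apply]; exact key _ (Subtype.ext (poincareInv_apply_add _ _ _))
  · -- (iii) the push-forward of `∂₀` by the flat chart is eventually future-directed
    show ∀ᶠ τ in atTop, ∀ y ∈ (Minkowski.backgroundOn d.toOver.flatDomain).timeSlab τ,
      𝒟.timeOrientation.IsFutureDirected (mfderiv 𝓘(ℝ, E4) (𝓡 4) d.toOver.flatChart y (E4.basisVector 0))
    filter_upwards [eventually_isTimelike_flat 𝒟.toSpacetime (U := d.toOver.flatDomain) d.toOver.flatChart
      d.toOver.tendsto_deviationCk_flat, eventually_gt_atTop d.toOver.τ₀] with τ hτ hττ₀ y hy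
    have hy' : (y : E4) 0 = τ := hy
    exact horient.2.2 y (by rw [hy']; exact hττ₀) (hτ y hy)

end Summit.FinalStateConjecture.FinalStateConjecture.Theorems.SymplecticDualOfTheBomb

end
-- ===== END inlined copy of p136225 =====

-- ===== BEGIN m5 variants of two p136225 theorems over clause (ii) ALONE (currency-agnostic; same proofs) =====
set_option linter.dupNamespace false

noncomputable section

open scoped Manifold ContDiff Topology ENNReal
open Set Filter Function Literature.Geometry.Lorentzian

namespace Summit.FinalStateConjecture.FinalStateConjecture.Theorems.SymplecticDualOfTheBomb

open Summit.FinalStateConjecture.FinalStateConjecture.Theorems.OneLockedExplosion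

section RaysB

variable {X : Type} [TopologicalSpace X] [ChartedSpace E3 X] [IsManifold (𝓡 3) ∞ X] [ConnectedSpace X]
  {D : InitialDataSet (𝓡 3) X}

/-- **`O ∩ I⁻(docCharted d) ⊆ exteriorOf 𝒟 (recutCharted d M a Θ τ₁)`** — m5 variant of the p136225 theorem of the same name
without `_of_ii`, taking ONLY the exhaustiveness clause (ii) (the sole clause its proof uses), so that it serves the r4
currency and the boost-honest m5 currency alike. [cite: DafermosLuk2017, Conjecture 1 (b)–(c)] -/
theorem inter_chronologicalPast_docCharted_subset_exteriorOf_recutCharted_of_ii (𝒟 : CauchyDevelopment D)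
    {O : Set 𝒟.carrier} {k : ℕ} (d : StationaryFinalStateDecomposition 𝒟.toSpacetime O k)
    {M a c r₀ : Fin d.N → ℝ} {Θ : Fin d.N → E4 → E4} (hO : O = Summit.FinalStateConjecture.exteriorOf 𝒟 d.charted)
    (hex : ∃ R : Fin d.N → ℝ → ℝ, ∀ τ₁ : ℝ, d.toOver.τ₀ < τ₁ →
      (O ∩ 𝒟.metric.chronologicalPast 𝒟.timeOrientation (docCharted d)) \ docCertifiedLate d R τ₁ ⊆
        𝒟.metric.causalPast 𝒟.timeOrientation (docCertifiedSlab d R τ₁))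
    (hK : ∀ i, IsKerrChartedWith (d.hole i) (d.adapted i) (M i) (a i) (c i) (r₀ i) (Θ i))
    (hmaps : ∀ i, MapsTo (recutMap (d.motion i).1 (d.motion i).2 (Θ i))
      ((recutBackground d M a i).domain : Set E4) ((d.background i).domain : Set E4))
    {L : Fin d.N → ℝ} (hL : ∀ i, ∀ u ∈ (Kerr.exterior (M i) (a i) : Set E4), |Θ i u 0 - c i * u 0| ≤ L i)
    {τ₁ : ℝ} (hτ₀τ₁ : d.toOver.τ₀ ≤ τ₁)
    (hlate : ∀ i, 𝒟.toSpacetime.IsLateChart (recutBackground d M a i) O τ₁ (recutChart d M a Θ hmaps i))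
    (hflat : 𝒟.toSpacetime.IsLateChart (Minkowski.backgroundOn d.toOver.flatDomain) O τ₁ d.toOver.flatChart) :
    O ∩ 𝒟.metric.chronologicalPast 𝒟.timeOrientation (docCharted d) ⊆
      Summit.FinalStateConjecture.exteriorOf 𝒟 (recutCharted d M a Θ τ₁) := by
  classical
  obtain ⟨R, hii⟩ := hex
  rintro p ⟨hpO, hpI⟩
  refine ⟨by rw [hO] at hpO; exact hpO.1, ?_⟩
  -- points of `O` in an open piece of `recutCharted τ₁` are chronologically before it
  have hOI : ∀ q ∈ O, ∀ U : Set 𝒟.carrier, IsOpen U → q ∈ U → U ⊆ recutCharted d M a Θ τ₁ →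
      q ∈ 𝒟.metric.chronologicalPast 𝒟.timeOrientation (recutCharted d M a Θ τ₁) := fun q hq U hU hqU hUsub ↦ by
    rw [hO] at hq
    exact LorentzianMetric.chronologicalFuture_mono hUsub (mem_chronologicalPast_of_isOpen hq.2 hU hqU)
  -- a late enough chart time `τ`: beyond `T(p)`, `τ₁` and every `cᵢ τ₁ + Lᵢ`
  obtain ⟨T, hT₀, hT⟩ := exists_forall_not_mem_certifiedLate d.toOver R p
  obtain ⟨T', hT'⟩ := Finite.exists_le fun i ↦ c i * τ₁ + L i
  set τ : ℝ := max T (max T' τ₁) + 1 with hτ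
  have hτT' : ∀ i, c i * τ₁ + L i < τ := fun i ↦ ((hT' i).trans ((le_max_left _ _).trans (le_max_right _ _))).trans_lt (lt_add_one _)
  have hττ₁ : τ₁ < τ := ((le_max_right _ _).trans (le_max_right _ _)).trans_lt (lt_add_one _)
  have hττ₀ : d.toOver.τ₀ < τ := hτ₀τ₁.trans_lt hττ₁
  -- `p` is causally before the d.o.c.-certified slab at `τ`, which is chronologically before `recutCharted τ₁`
  have hpslab : p ∈ 𝒟.metric.causalPast 𝒟.timeOrientation (docCertifiedSlab d R τ) := hii τ hττ₀
    ⟨⟨hpO, hpI⟩, fun h ↦ hT τ ((le_max_left _ _).trans (lt_add_one _).le) (docCertifiedLate_subset_certifiedLate d R τ h)⟩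
  refine causalPast_subset_chronologicalPast (by exact_mod_cast le_top) (fun q hq ↦ ?_) hpslab
  rcases hq with ⟨y, hy, rfl⟩ | hq
  · -- a flat slab point of time `τ > τ₁`
    have hy' : (y : E4) 0 = τ := hy
    have hy₁ : y ∈ (Minkowski.backgroundOn d.toOver.flatDomain).lateRegion τ₁ := by show τ₁ < (y : E4) 0; rw [hy']; exact hττ₁
    refine hOI _ (hflat.image_subset ⟨y, hy₁, rfl⟩) _ (isOpen_image_of_isLateChart hflat) ⟨y, hy₁, rfl⟩ ?_
    rw [recutCharted_eq d M a Θ hmaps]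
    exact subset_union_left
  · -- a d.o.c. hole slab point `ψᵢ x`, `P⁻¹ x = Θᵢ u`: the recut chart point of `z = P u`, Kerr–Schild time `u⁰ > τ₁`
    obtain ⟨i, hi⟩ := mem_iUnion.1 hq
    obtain ⟨x, ⟨hxs, hxd⟩, rfl⟩ := hi
    obtain ⟨u, hu, hux⟩ : poincareInv (d.motion i).1 (d.motion i).2 x.1 ∈ Θ i '' (Kerr.exterior (M i) (a i) : Set E4) := by
      rw [(hK i).2.2.2.2.2.2.2.2.2.1]; exact hxd
    have hx0 : (poincareInv (d.motion i).1 (d.motion i).2 x.1) 0 = τ := hxs.1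
    have hu0 : τ₁ < u 0 := by
      have h1 := (abs_le.1 (hL i u hu)).2
      rw [hux, hx0] at h1
      have h2 : c i * τ₁ < c i * u 0 := by linarith [hτT' i]
      exact lt_of_mul_lt_mul_left h2 (hK i).2.1.le
    set z : E4 := ((d.motion i).1 : E4 ≃L[ℝ] E4) u + (d.motion i).2 with hz_def
    have hz : z ∈ ((recutBackground d M a i).domain : Set E4) := by
      show poincareInv (d.motion i).1 (d.motion i).2 z ∈ (Kerr.exterior (M i) (a i) : Set E4)
      rw [hz_def, poincareInv_apply_add]; exact hu
    have hzlate : (⟨z, hz⟩ : (recutBackground d M a i).domain) ∈ (recutBackground d M a i).lateRegion τ₁ := by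
      show τ₁ < (poincareInv (d.motion i).1 (d.motion i).2 z) 0
      rw [hz_def, poincareInv_apply_add]; exact hu0
    have hqeq : recutChart d M a Θ hmaps i ⟨z, hz⟩ = d.toOver.chart i x := by
      show d.toOver.chart i _ = d.toOver.chart i x
      congr 1; apply Subtype.ext
      show ((d.motion i).1 : E4 ≃L[ℝ] E4) (Θ i (poincareInv (d.motion i).1 (d.motion i).2 z)) + (d.motion i).2 = x.1
      rw [hz_def, poincareInv_apply_add, hux, apply_poincareInv_add]
    have hxlate : x ∈ (d.background i).lateRegion d.toOver.τ₀ := by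
      show d.toOver.τ₀ < (poincareInv (d.motion i).1 (d.motion i).2 x.1) 0
      rw [hx0]; exact hττ₀
    refine hOI _ ((d.toOver.isLateChart i).image_subset ⟨x, hxlate, rfl⟩) _ (isOpen_image_of_isLateChart (hlate i))
      ⟨⟨z, hz⟩, hzlate, hqeq⟩ ?_
    rw [recutCharted_eq d M a Θ hmaps]
    exact subset_union_of_subset_right
      (subset_iUnion (fun j ↦ recutChart d M a Θ hmaps j '' (recutBackground d M a j).lateRegion τ₁) i) _

end RaysB

/-- **The T2 chart transfer over clause (ii) ALONE** — m5 variant of `chartTransferT2_unfolded` (p136225) with the hypothesis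
`HasExhaustiveDocCharts' d` replaced by the existential exhaustiveness clause (ii), the only clause the landed proof consumes
(through `inter_chronologicalPast_docCharted_subset_exteriorOf_recutCharted_of_ii`); proof byte-identical otherwise.
[cite: DafermosLuk2017, Conjecture 1 (b)–(c)] -/
theorem chartTransferT2_of_ii : ∀ (X : Type) [TopologicalSpace X] [ChartedSpace E3 X] [IsManifold (𝓡 3) ∞ X] [T2Space X] [SecondCountableTopology X] [ConnectedSpace X] (D : InitialDataSet (𝓡 3) X) (𝒟 : VacuumCauchyDevelopment D) (O : Set 𝒟.carrier) (d : StationaryFinalStateDecomposition 𝒟.toSpacetime O 2) (M a c r₀ : Fin d.N → ℝ) (Θ : Fin d.N → E4 → E4), O = Summit.FinalStateConjecture.exteriorOf 𝒟.toCauchyDevelopment d.charted → (∃ R : Fin d.N → ℝ → ℝ, ∀ τ₁ : ℝ, d.toOver.τ₀ < τ₁ → (O ∩ 𝒟.metric.chronologicalPast 𝒟.timeOrientation (docCharted d)) \ docCertifiedLate d R τ₁ ⊆ 𝒟.metric.causalPast 𝒟.timeOrientation (docCertifiedSlab d R τ₁)) → IsHorizonNormalised d → (∀ i, IsKerrChartedWith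 (d.hole i) (d.adapted i) (M i) (a i) (c i) (r₀ i) (Θ i)) → (∀ i, ∀ u ∈ (Kerr.exterior (M i) (a i) : Set E4), ∀ h : Θ i u ∈ (d.adapted i).domain, (d.hole i).timeOrientation.IsFutureDirected (mfderiv 𝓘(ℝ, E4) (𝓡 4) (d.adapted i).toFun ⟨Θ i u, h⟩ (fderiv ℝ (Θ i) u (Kerr.timeVector (M i) (a i) u)))) → KerrSchildRecutCovering 𝒟 d M a Θ → Summit.FinalStateConjecture.RaysStayInClosure 𝒟.toCauchyDevelopment (O ∩ 𝒟.metric.chronologicalPast 𝒟.timeOrientation (docCharted d)) → ((∀ i, Summit.FinalStateConjecture.IsOrthochronous (d.motion i).1) ∧ (∀ (i : Fin d.N) (y : (d.background i).domain) (w : E4), d.toOver.τ₀ < (d.background i).time y.1 → (d.hole i).timeOrientation.IsFutureDirected (mfderiv 𝓘(ℝ, E4) (𝓡 4) (d.adapted i).toFun ⟨poincareInv (d.motion i).1 (d.motion i).2 y.1, ModelBackground.mem_boost_domain.1 y.2⟩ (((d.motion i).1 : E4 ≃L[ℝ] E4).symm w)) → 𝒟.metric.IsTimelike (mfderiv 𝓘(ℝ,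 E4) (𝓡 4) (d.toOver.chart i) y w) → 𝒟.timeOrientation.IsFutureDirected (mfderiv 𝓘(ℝ, E4) (𝓡 4) (d.toOver.chart i) y w)) ∧ ∀ y : d.toOver.flatDomain, d.toOver.τ₀ < (y : E4) 0 → 𝒟.metric.IsTimelike (mfderiv 𝓘(ℝ, E4) (𝓡 4) d.toOver.flatChart y (E4.basisVector 0)) → 𝒟.timeOrientation.IsFutureDirected (mfderiv 𝓘(ℝ, E4) (𝓡 4) d.toOver.flatChart y (E4.basisVector 0))) → ∃ (O' : Set 𝒟.carrier) (d' : FinalStateDecomposition 𝒟.toSpacetime O' 2), (∀ i, Kerr.IsSubextremal (d'.mass i) (d'.spin i)) ∧ O' = Summit.FinalStateConjecture.exteriorOf 𝒟.toCauchyDevelopment d'.charted ∧ Summit.FinalStateConjecture.RaysStayInClosure 𝒟.toCauchyDevelopment O' ∧ Summit.FinalStateConjecture.HasExhaustiveCharts d' ∧ Summit.FinalStateConjecture.IsFutureOriented d' := by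
  intro X _ _ _ _ _ _ D 𝒟 O d M a c r₀ Θ hO hex _ hK hF5 hG hrays horient
  -- the clauses of `IsKerrChartedWith`
  have hsub := fun i ↦ (hK i).1
  have hc := fun i ↦ (hK i).2.1
  have hr₀ := fun i ↦ (hK i).2.2.2.1
  have hΘs := fun i ↦ (hK i).2.2.2.2.1
  have hinj := fun i ↦ (hK i).2.2.2.2.2.1
  have hΘm := fun i ↦ (hK i).2.2.2.2.2.2.1
  have hΘe := fun i ↦ (hK i).2.2.2.2.2.2.2.1
  have hiso := fun i ↦ (hK i).2.2.2.2.2.2.2.2.1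
  have hsubreg : ∀ i, (Kerr.exterior (M i) (a i) : Set E4) ⊆ (Kerr.region (a i) (r₀ i) : Set E4) :=
    fun i z hz ↦ Kerr.mem_region.2 ((max_le_max (hr₀ i).le le_rfl).trans_lt (Kerr.mem_exterior.1 hz))
  -- the recut maps carry the boosted exteriors into the moved adapted domains
  have hmaps : ∀ i, MapsTo (recutMap (d.motion i).1 (d.motion i).2 (Θ i))
      ((recutBackground d M a i).domain : Set E4) ((d.background i).domain : Set E4) := fun i x hx ↦
    mapsTo_conj (d.motion i).1 (d.motion i).2 (hΘm i) (hsubreg i (mem_boostedKerrExterior.1 hx))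
  obtain ⟨τ₀', R', hτ₀', hR', hconv, -, hii⟩ := hG hmaps
  -- tilt bounds and the new late time `τ₁`
  choose L hL using fun i ↦ kerrChartedWith_tilt_bound _ _ _ _ _ _ _ (hK i)
  obtain ⟨T, hT⟩ := Finite.exists_le fun i ↦ (d.toOver.τ₀ + L i) / c i
  obtain ⟨τ₁, hτ₀'τ₁, hTτ₁⟩ : ∃ τ₁ : ℝ, τ₀' < τ₁ ∧ T ≤ τ₁ := ⟨max (τ₀' + 1) T, (lt_add_one _).trans_le (le_max_left _ _), le_max_right _ _⟩
  have hτ₀τ₁ : d.toOver.τ₀ ≤ τ₁ := hτ₀'.trans hτ₀'τ₁.le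
  have htilt : ∀ i, ∀ u ∈ (Kerr.exterior (M i) (a i) : Set E4), τ₁ < u 0 → d.toOver.τ₀ < Θ i u 0 := by
    intro i u hu hu0
    have h2 : (d.toOver.τ₀ + L i) / c i ≤ τ₁ := (hT i).trans hTτ₁
    rw [div_le_iff₀ (hc i)] at h2
    nlinarith [mul_lt_mul_of_pos_left hu0 (hc i), (abs_le.1 (hL i u hu)).1]
  -- the hole charts: late charts into `O`, then into `O'`
  have himgO : ∀ i, recutChart d M a Θ hmaps i '' (recutBackground d M a i).lateRegion τ₁ ⊆ O := by
    rintro i _ ⟨y, hy, rfl⟩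
    refine (d.toOver.isLateChart i).image_subset ⟨⟨_, hmaps i y.2⟩, ?_, rfl⟩
    show d.toOver.τ₀ < (poincareInv (d.motion i).1 (d.motion i).2
      (((d.motion i).1 : E4 ≃L[ℝ] E4) (Θ i (poincareInv (d.motion i).1 (d.motion i).2 y.1)) + (d.motion i).2)) 0
    rw [poincareInv_apply_add]; exact htilt i _ (mem_boostedKerrExterior.1 y.2) hy
  have hlateO : ∀ i, 𝒟.toSpacetime.IsLateChart (recutBackground d M a i) O τ₁ (recutChart d M a Θ hmaps i) :=
    fun i ↦ isLateChart_recut (d.adapted i) (d.motion i).1 (d.motion i).2 (d.toOver.isLateChart i)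
      (hr₀ i).le (hΘs i) (hinj i) (hiso i) (hmaps i) (htilt i) (himgO i)
  have hlate : ∀ i, 𝒟.toSpacetime.IsLateChart (recutBackground d M a i)
      (Summit.FinalStateConjecture.exteriorOf 𝒟.toCauchyDevelopment (recutCharted d M a Θ τ₁)) τ₁
      (recutChart d M a Θ hmaps i) := fun i ↦
    ⟨(hlateO i).contMDiff, (hlateO i).isOpenEmbedding,
      subset_exteriorOf_of_isOpen _ ((himgO i).trans hO.subset) (isOpen_image_of_isLateChart (hlateO i)) (by
        rw [recutCharted_eq d M a Θ hmaps]
        exact subset_union_of_subset_right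
          (subset_iUnion (fun i ↦ recutChart d M a Θ hmaps i '' (recutBackground d M a i).lateRegion τ₁) i) _)⟩
  -- the flat chart, re-based at `τ₁`
  have hflatimg : d.toOver.flatChart '' (Minkowski.backgroundOn d.toOver.flatDomain).lateRegion τ₁ ⊆ O :=
    (image_mono ((Minkowski.backgroundOn d.toOver.flatDomain).lateRegion_mono hτ₀τ₁)).trans
      d.toOver.isLateChart_flat.image_subset
  have hflatO : 𝒟.toSpacetime.IsLateChart (Minkowski.backgroundOn d.toOver.flatDomain) O τ₁ d.toOver.flatChart :=
    isLateChart_rebase _ d.toOver.isLateChart_flat hτ₀τ₁ (isOpen_lateRegion_backgroundOn _ _) hflatimg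
  have hflat : 𝒟.toSpacetime.IsLateChart (Minkowski.backgroundOn d.toOver.flatDomain)
      (Summit.FinalStateConjecture.exteriorOf 𝒟.toCauchyDevelopment (recutCharted d M a Θ τ₁)) τ₁ d.toOver.flatChart :=
    ⟨hflatO.contMDiff, hflatO.isOpenEmbedding, subset_exteriorOf_of_isOpen _ (hflatimg.trans hO.subset)
      (isOpen_image_of_isLateChart hflatO) subset_union_left⟩
  -- near-zone convergence for every radius, separation, excision
  have hconv' : ∀ i (R : ℝ), Tendsto (fun τ ↦ 𝒟.toSpacetime.truncDeviationCk (recutBackground d M a i)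
      (recutChart d M a Θ hmaps i) 2 R τ) atTop (𝓝 0) := fun i ↦ tendsto_truncDeviationCk_of_tendsto_atTop _ _ _ (hR' i) (hconv i)
  have hsep := separation_recut d M a c r₀ Θ hmaps hsub hc hr₀ (fun i ↦ (hΘs i).continuousOn) hΘm hΘe
  obtain ⟨ρ, hρ, hρdom⟩ := excision_transfer 𝒟.toSpacetime O 2 d a
  -- the covering clause at `τ₁` (`hcov` below) and exhaustiveness (ii) come from (ii) of the covering
  have hanti := exteriorOf_mono 𝒟.toCauchyDevelopment (recutCharted_anti d M a Θ hτ₀'τ₁.le)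
  -- honest radii: raise the growing radii `R'` of the covering to at least `max (r₊, 0) + 1`
  set R'' : Fin d.N → ℝ → ℝ := fun i τ ↦ max (R' i τ) (max (Kerr.rPlus (M i) (a i)) 0 + 1) with hR''
  have hR'le : ∀ i τ, R' i τ ≤ R'' i τ := fun i τ ↦ le_max_left _ _
  have hconv'' : ∀ i, Tendsto (fun τ ↦ 𝒟.toSpacetime.truncDeviationCk (recutBackground d M a i)
      (recutChart d M a Θ hmaps i) 2 (R'' i τ) τ) atTop (𝓝 0) := by
    refine fun i ↦ (hconv i).congr' ?_
    filter_upwards [(hR' i).eventually_ge_atTop (max (Kerr.rPlus (M i) (a i)) 0 + 1)] with τ hτ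
    simp only [hR'', max_eq_left hτ]; rfl
  have hlate_mono : ∀ τ₂, recutCertifiedLate d M a Θ R' τ₂ ⊆ recutCertifiedLate d M a Θ R'' τ₂ :=
    fun τ₂ ↦ union_subset_union le_rfl (iUnion_mono fun i ↦ recutImage_mono d Θ i
      (image_mono fun x hx ↦ ⟨hx.1, hx.2.trans (hR'le i _)⟩))
  have hslab_mono : ∀ τ₂, recutCertifiedSlab d M a Θ R' τ₂ ⊆ recutCertifiedSlab d M a Θ R'' τ₂ :=
    fun τ₂ ↦ union_subset_union le_rfl (iUnion_mono fun i ↦ recutImage_mono d Θ i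
      (image_mono ((recutBackground d M a i).truncTimeSlab_mono (hR'le i τ₂) τ₂)))
  refine ⟨_, recutDecomposition d M a Θ hmaps τ₁ (fun i ↦ (hsub i).pos) (fun i ↦ (hsub i).le) hlate hconv' hsep ρ hρ
    (hρdom τ₁ hτ₀τ₁) hflat (fun p hp ↦ LorentzianMetric.causalFuture_mono (recutCertifiedSlab_subset d M a Θ hmaps R' τ₁)
      (hii τ₁ hτ₀'τ₁ ⟨hanti hp.1, fun h ↦ hp.2 (recutCertifiedLate_subset d M a Θ hmaps R' τ₁ h)⟩)), hsub, ?_, ?_,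
    ⟨R'', fun i ↦ ⟨tendsto_atTop_mono (hR'le i) (hR' i), fun τ ↦ le_max_right _ _⟩, hconv'', fun τ₂ hτ₂ ↦ ?_⟩, horient.1,
    fun i ρ' ↦ ?_, ?_⟩
  · rw [charted_recutDecomposition]
  · -- the ray clause: `O ∩ I⁻(docCharted d) ⊆ O'`
    exact raysStayInClosure_mono 𝒟.toCauchyDevelopment (inter_chronologicalPast_docCharted_subset_exteriorOf_recutCharted_of_ii
      𝒟.toCauchyDevelopment d hO hex hK hmaps hL hτ₀τ₁ hlateO hflatO) hrays
  · rw [certifiedLate_recutDecomposition, certifiedSlab_recutDecomposition]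
    exact fun p hp ↦ LorentzianMetric.causalFuture_mono (hslab_mono τ₂)
      (hii τ₂ (hτ₀'τ₁.trans hτ₂) ⟨hanti hp.1, fun h ↦ hp.2 (hlate_mono τ₂ h)⟩)
  · -- (ii) the push-forwards of `Λᵢ V_{Mᵢ,aᵢ}` by the recut hole charts are eventually future-directed
    show ∀ᶠ τ in atTop, ∀ x ∈ (recutBackground d M a i).truncTimeSlab ρ' τ,
      𝒟.timeOrientation.IsFutureDirected (mfderiv 𝓘(ℝ, E4) (𝓡 4) (recutChart d M a Θ hmaps i) x
        (((d.motion i).1 : E4 ≃L[ℝ] E4) (Kerr.timeVector (M i) (a i) (poincareInv (d.motion i).1 (d.motion i).2 x.1))))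
    have hΘd : ∀ u ∈ (Kerr.exterior (M i) (a i) : Set E4), DifferentiableAt ℝ (Θ i) u := fun u hu ↦
      ((hΘs i).differentiableOn (by simp)).differentiableAt ((Kerr.region _ _).isOpen.mem_nhds (hsubreg i hu))
    have hΦ : ContDiffOn ℝ ∞ (recutMap (d.motion i).1 (d.motion i).2 (Θ i)) ((recutBackground d M a i).domain : Set E4) :=
      (contDiffOn_conj (d.motion i).1 (d.motion i).2 (hΘs i)).mono fun z hz ↦ hsubreg i (mem_boostedKerrExterior.1 hz)
    -- chain rule: `d(ψᵢ ∘ recutMap Θᵢ)_x v = dψᵢ (Λ (dΘᵢ (Λ⁻¹ v)))`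
    have hchain : ∀ (x : (recutBackground d M a i).domain) (v : E4),
        mfderiv 𝓘(ℝ, E4) (𝓡 4) (recutChart d M a Θ hmaps i) x v =
          mfderiv 𝓘(ℝ, E4) (𝓡 4) (d.toOver.chart i) ⟨recutMap (d.motion i).1 (d.motion i).2 (Θ i) x.1, hmaps i x.2⟩
            (((d.motion i).1 : E4 ≃L[ℝ] E4) (fderiv ℝ (Θ i) (poincareInv (d.motion i).1 (d.motion i).2 x.1)
              (((d.motion i).1 : E4 ≃L[ℝ] E4).symm v))) := by
      intro x v
      have hd : mfderiv 𝓘(ℝ, E4) (𝓡 4) (recutChart d M a Θ hmaps i) x =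
          (mfderiv 𝓘(ℝ, E4) (𝓡 4) (d.toOver.chart i) ⟨recutMap (d.motion i).1 (d.motion i).2 (Θ i) x.1, hmaps i x.2⟩).comp
            (mfderiv 𝓘(ℝ, E4) 𝓘(ℝ, E4) (fun y : (recutBackground d M a i).domain ↦
              (⟨recutMap (d.motion i).1 (d.motion i).2 (Θ i) y.1, hmaps i y.2⟩ : (d.background i).domain)) x) :=
        mfderiv_comp x ((d.toOver.isLateChart i).contMDiff.mdifferentiableAt (by simp))
          ((contMDiff_readapt (hmaps i) hΦ).mdifferentiableAt (by simp))
      rw [hd, mfderiv_readapt (hmaps i) hΦ x]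
      show mfderiv 𝓘(ℝ, E4) (𝓡 4) (d.toOver.chart i) ⟨_, hmaps i x.2⟩ (fderiv ℝ (fun x ↦ ((d.motion i).1 : E4 ≃L[ℝ] E4)
        (Θ i (poincareInv (d.motion i).1 (d.motion i).2 x)) + (d.motion i).2) x.1 v) = _
      rw [fderiv_conj _ _ (hΘd _ (mem_boostedKerrExterior.1 x.2))]; rfl
    filter_upwards [eventually_isTimelike_boostedKerr 𝒟.toSpacetime (hsub i) (recutChart d M a Θ hmaps i) ρ' (hconv' i ρ'),
      eventually_gt_atTop τ₁] with τ hτ hττ₁ x hx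
    have hu : poincareInv (d.motion i).1 (d.motion i).2 x.1 ∈ (Kerr.exterior (M i) (a i) : Set E4) :=
      mem_boostedKerrExterior.1 x.2
    have hx0 : (poincareInv (d.motion i).1 (d.motion i).2 x.1) 0 = τ := hx.1
    have hmem : Θ i (poincareInv (d.motion i).1 (d.motion i).2 x.1) ∈ (d.adapted i).domain := hΘm i (hsubreg i hu)
    have htime : d.toOver.τ₀ < (d.background i).time (recutMap (d.motion i).1 (d.motion i).2 (Θ i) x.1) := by
      show d.toOver.τ₀ < (poincareInv (d.motion i).1 (d.motion i).2 (((d.motion i).1 : E4 ≃L[ℝ] E4)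
        (Θ i (poincareInv (d.motion i).1 (d.motion i).2 x.1)) + (d.motion i).2)) 0
      rw [poincareInv_apply_add]; exact htilt i _ hu (by rw [hx0]; exact hττ₁)
    have key : ∀ p : (d.adapted i).domain, p = ⟨Θ i (poincareInv (d.motion i).1 (d.motion i).2 x.1), hmem⟩ →
        (d.hole i).timeOrientation.IsFutureDirected (mfderiv 𝓘(ℝ, E4) (𝓡 4) (d.adapted i).toFun p (fderiv ℝ (Θ i)
          (poincareInv (d.motion i).1 (d.motion i).2 x.1) (Kerr.timeVector (M i) (a i) (poincareInv (d.motion i).1 (d.motion i).2 x.1)))) := by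
      rintro p rfl; exact hF5 i _ hu hmem
    have hTL : 𝒟.metric.IsTimelike (mfderiv 𝓘(ℝ, E4) (𝓡 4) (recutChart d M a Θ hmaps i) x
        (((d.motion i).1 : E4 ≃L[ℝ] E4) (Kerr.timeVector (M i) (a i) (poincareInv (d.motion i).1 (d.motion i).2 x.1)))) :=
      hτ x hx
    rw [hchain, ContinuousLinearEquiv.symm_apply_apply] at hTL
    have h := horient.2.1 i ⟨recutMap (d.motion i).1 (d.motion i).2 (Θ i) x.1, hmaps i x.2⟩ _ htime ?_ hTL
    · rw [hchain, ContinuousLinearEquiv.symm_apply_apply]; exact h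
    · rw [ContinuousLinearEquiv.symm_apply_apply]; exact key _ (Subtype.ext (poincareInv_apply_add _ _ _))
  · -- (iii) the push-forward of `∂₀` by the flat chart is eventually future-directed
    show ∀ᶠ τ in atTop, ∀ y ∈ (Minkowski.backgroundOn d.toOver.flatDomain).timeSlab τ,
      𝒟.timeOrientation.IsFutureDirected (mfderiv 𝓘(ℝ, E4) (𝓡 4) d.toOver.flatChart y (E4.basisVector 0))
    filter_upwards [eventually_isTimelike_flat 𝒟.toSpacetime (U := d.toOver.flatDomain) d.toOver.flatChart
      d.toOver.tendsto_deviationCk_flat, eventually_gt_atTop d.toOver.τ₀] with τ hτ hττ₀ y hy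
    have hy' : (y : E4) 0 = τ := hy
    exact horient.2.2 y (by rw [hy']; exact hττ₀) (hτ y hy)

end Summit.FinalStateConjecture.FinalStateConjecture.Theorems.SymplecticDualOfTheBomb

end
-- ===== END m5 variants =====


noncomputable section

set_option linter.dupNamespace false
set_option maxSynthPendingDepth 3

open scoped Manifold ContDiff Topology BigOperators
open Set Filter Bundle MeasureTheory Literature.Geometry.Lorentzian
open Summit.FinalStateConjecture.FinalStateConjecture.Theses.ZeroEnergyKerrOrBomb

namespace Summit.FinalStateConjecture.FinalStateConjecture.Cruxes.FinalStateFromKerrOrBomb.SketchIdeator1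

-- landed vocabulary: sibling Defs (p85447) and the predecessor line's Defs/Defs2/Sig/Sig4 + helper files
open Summit.FinalStateConjecture.FinalStateConjecture.Theorems.OneLockedExplosion
open Summit.FinalStateConjecture.FinalStateConjecture.Theorems.SymplecticDualOfTheBomb

/-! ## §0M The rev-6 telescope of `KerrOrBombModT` as a predicate on holes (NEW vocabulary of this crux) -/

/-- **The telescope of the route's rev-6 target `KerrOrBombModT`** on a stationary AF black hole `𝓑` — VERBATIM its hypotheses
before "Killing-mode-stable", the collar `(U, K)` bundled existentially, under the tree's Levi-Civita connection
`PseudoRiemannianMetric.hasLeviCivita`: vacuum; `I⁺`-regular (Chruściel–Costa Def. 1.1); future-presented (every event in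
`I⁺(M_ext)`); `T ≠ 0` on the d.o.c.; simply connected d.o.c.; an open `U ⊇ 𝓔⁺`, `𝓔⁺` connected, and a field `K` smooth and Killing
on `U`, `[T, K] = 0` on `U`, `K ≠ 0` on `𝓔⁺` and tangent to it, `K` timelike on `U ∩ doc`; the closed ergoregion off `U` compact
modulo `T`. [cite: ChruscielCosta2008, Def. 1.1 and §2.4–2.5] [cite: AlexakisIonescuKlainerman2010, Thm. 1.1] -/
def InTelescopeModT (𝓑 : StationaryAFBlackHole.{0}) : Prop :=
  haveI : 𝓑.metric.HasLeviCivita := 𝓑.metric.toPseudoRiemannianMetric.hasLeviCivita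
  𝓑.metric.toPseudoRiemannianMetric.IsRicciFlat ∧ 𝓑.IsIPlusRegular ∧
    (∀ p : 𝓑.carrier, p ∈ 𝓑.metric.chronologicalFuture 𝓑.timeOrientation 𝓑.Mext) ∧
      (∀ p ∈ 𝓑.doc, 𝓑.killing p ≠ 0) ∧ SimplyConnectedSpace 𝓑.doc ∧
        ∃ (U : Set 𝓑.carrier) (K : Π x : 𝓑.carrier, TangentSpace (𝓡 4) x), IsOpen U ∧ 𝓑.horizon ⊆ U ∧
          IsConnected 𝓑.horizon ∧
          ContMDiffOn (𝓡 4) ((𝓡 4).prod 𝓘(ℝ, Literature.Geometry.Lorentzian.E4)) ((⊤ : ℕ∞) : WithTop ℕ∞)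
            (fun x ↦ (Bundle.TotalSpace.mk' Literature.Geometry.Lorentzian.E4 x (K x) : TangentBundle (𝓡 4) 𝓑.carrier)) U ∧
          (∀ x ∈ U, ∀ v w : TangentSpace (𝓡 4) x, 𝓑.metric.val x (𝓑.metric.leviCivita K x v) w +
            𝓑.metric.val x v (𝓑.metric.leviCivita K x w) = 0) ∧
          (∀ x ∈ U, VectorField.mlieBracket (𝓡 4) 𝓑.killing K x = 0) ∧ (∀ p ∈ 𝓑.horizon, K p ≠ 0) ∧
          (∀ γ : ℝ → 𝓑.carrier, IsMIntegralCurve γ K → γ 0 ∈ 𝓑.horizon → ∀ t, γ t ∈ 𝓑.horizon) ∧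
          (∀ x ∈ U ∩ 𝓑.doc, 𝓑.metric.val x (K x) (K x) < 0) ∧
          ∃ S₀ : Set 𝓑.carrier, IsCompact S₀ ∧ S₀ ⊆ 𝓑.doc ∧ ∀ y ∈ 𝓑.doc,
            0 ≤ 𝓑.metric.val y (𝓑.killing y) (𝓑.killing y) → y ∉ U →
              y ∈ Literature.Geometry.Lorentzian.stationaryOrbit 𝓑.killing S₀

/-- **Mode-stable hole of the rev-6 telescope**: `InTelescopeModT ∧ ModeStable` (the property of the limit holes of a GOOD member;
X identifies such holes with sub-extremal Kerr exteriors). [cite: ShlapentokhRothman2015ModeStability, §1.3] -/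
def ModeStableModT (𝓑 : StationaryAFBlackHole.{0}) : Prop :=
  InTelescopeModT 𝓑 ∧ ModeStable 𝓑

/-! ## §0 Vocabulary of reshape r7 — INLINED copy of `Theorems/ZeroEnergyKerrOrBombSymplecticDualOfTheBombSig7.lean` (p130945 ACCEPTED,
not yet built on the farm, so the workfile cannot import it yet; byte-identical bodies) -/

section Summit

variable (X : Type) [TopologicalSpace X] [ChartedSpace E3 X] [IsManifold (𝓡 3) ∞ X]
  [T2Space X] [SecondCountableTopology X] [ConnectedSpace X]

/-- The property the RE-TYPED summit asserts generically of an admissible datum `D` on `X` — VERBATIM the lambda of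
`FinalStateConjecture` after p126844 (so that `summitT2_iff` is `Iff.rfl`): an MGHD exists, and every MGHD has complete
`𝓘⁺` and a sub-extremal `N`-Kerr final-state decomposition `d` of its self-determined exterior `O` such that every
future-complete normalised null ray from the data stays in `closure O`, the charts exhaust `O` (honest radii), and chart
time is future-oriented. The pre-re-type lambda is `OneLockedExplosion.SummitProperty`. [cite: DafermosLuk2017, Conjecture 1 and §1.2.1] -/
def SummitPropertyT2 (D : InitialDataSet (𝓡 3) X) : Prop :=
  (∃ 𝒟 : VacuumCauchyDevelopment D, 𝒟.IsMaximal) ∧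
    ∀ 𝒟 : VacuumCauchyDevelopment D, 𝒟.IsMaximal →
      Summit.FinalStateConjecture.HasCompleteNullInfinity 𝒟.toCauchyDevelopment ∧
        ∃ (O : Set 𝒟.carrier) (d : FinalStateDecomposition 𝒟.toSpacetime O 2),
          (∀ i, Kerr.IsSubextremal (d.mass i) (d.spin i)) ∧
            O = Summit.FinalStateConjecture.exteriorOf 𝒟.toCauchyDevelopment d.charted ∧
              Summit.FinalStateConjecture.RaysStayInClosure 𝒟.toCauchyDevelopment O ∧
                Summit.FinalStateConjecture.HasExhaustiveCharts d ∧
                  Summit.FinalStateConjecture.IsFutureOriented d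

omit [T2Space X] [SecondCountableTopology X] in
/-- The re-typed per-datum property implies the pre-re-type one (forget the ray clause and the orientation clause).
[folklore] -/
theorem summitPropertyT2_imp {D : InitialDataSet (𝓡 3) X} (h : SummitPropertyT2 X D) : SummitProperty X D := by
  refine ⟨h.1, fun 𝒟 h𝒟 ↦ ?_⟩
  obtain ⟨hcni, O, d, hsub, hO, -, hex, -⟩ := h.2 𝒟 h𝒟
  exact ⟨hcni, O, d, hsub, hO, hex⟩

end Summit

/-- The re-typed summit unfolded through `SummitPropertyT2` (definitional): TAME Christodoulou genericity of
`SummitPropertyT2` in the admissible class, on every slice. Registration device of this module. [folklore] -/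
theorem summitT2_iff :
    _root_.FinalStateConjecture ↔
      ∀ (X : Type) [TopologicalSpace X] [ChartedSpace E3 X] [IsManifold (𝓡 3) ∞ X] [T2Space X]
        [SecondCountableTopology X] [ConnectedSpace X],
        InitialDataSet.IsTameChristodoulouGeneric (admissibleVacuumData X) (SummitPropertyT2 X) 1 :=
  Iff.rfl

section Orientation

variable {X : Type} [TopologicalSpace X] [ChartedSpace E3 X] [IsManifold (𝓡 3) ∞ X]
  [ConnectedSpace X] {D : InitialDataSet (𝓡 3) X}

/-- **The settling charts respect the time orientations** (r7; the clause the re-typed summit's `IsFutureOriented` needs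
on the input side of the chart transfer). (i) Every asymptotic motion `Λᵢ` is orthochronous. (ii) For every hole `i`,
every LATE point `y` of the moved adapted background (rest-frame chart time `> τ₀`) and every `w : E4`: if the rest-frame vector `Λᵢ⁻¹ w`, pushed by the
adapted chart `Aᵢ` at `Λᵢ⁻¹(y − cᵢ)`, is FUTURE-directed for `𝓑ᵢ`, and the push-forward of `w` by the late chart `ψᵢ`
at `y` is timelike for `g_𝒟`, then that push-forward is future-directed for `(g_𝒟, τ_𝒟)`. (iii) Wherever, at a late
point (`x⁰ > τ₀`), the flat chart pushes `∂₀` to a `g_𝒟`-timelike vector, that vector is future-directed. These are statements about the SIGN only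
(future rather than past); that the relevant push-forwards are eventually timelike follows from the `C²` convergence on
the certified slabs and is not asserted here. Honest decompositions (charts read off a time function of `𝒟`) satisfy it
exactly; Kerr's own development with Kerr–Schild charts satisfies it. (ref: ONeill1983, Ch. 5 p. 145; DafermosLuk2017,
Conjecture 1) [cite: ONeill1983, Ch. 5  p. 145] -/
def IsOrientationCompatible (𝒟 : VacuumCauchyDevelopment D) {O : Set 𝒟.carrier} {k : ℕ}
    (d : StationaryFinalStateDecomposition 𝒟.toSpacetime O k) : Prop :=
  (∀ i, Summit.FinalStateConjecture.IsOrthochronous (d.motion i).1) ∧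
  (∀ (i : Fin d.N) (y : (d.background i).domain) (w : E4), d.toOver.τ₀ < (d.background i).time y.1 →
    (d.hole i).timeOrientation.IsFutureDirected
        (mfderiv 𝓘(ℝ, E4) (𝓡 4) (d.adapted i).toFun
          ⟨poincareInv (d.motion i).1 (d.motion i).2 y.1, ModelBackground.mem_boost_domain.1 y.2⟩
          (((d.motion i).1 : E4 ≃L[ℝ] E4).symm w)) →
      𝒟.metric.IsTimelike (mfderiv 𝓘(ℝ, E4) (𝓡 4) (d.toOver.chart i) y w) →
        𝒟.timeOrientation.IsFutureDirected (mfderiv 𝓘(ℝ, E4) (𝓡 4) (d.toOver.chart i) y w)) ∧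
  ∀ y : d.toOver.flatDomain, d.toOver.τ₀ < (y : E4) 0 →
    𝒟.metric.IsTimelike (mfderiv 𝓘(ℝ, E4) (𝓡 4) d.toOver.flatChart y (E4.basisVector 0)) →
      𝒟.timeOrientation.IsFutureDirected (mfderiv 𝓘(ℝ, E4) (𝓡 4) d.toOver.flatChart y (E4.basisVector 0))

/-- **Boost-honest exhaustiveness with the `R`-dependent chart-overlap clauses** (reshape m5 = the wave-6 boost audit W17,
evidence `evidence-W17-boost-audit.md`; replaces the r4 `HasExhaustiveDocCharts'` of Sig4 in this line's currency): near-zone radii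
`Rᵢ` with (i) `C²` convergence on the growing truncated rest-frame slabs; `Rᵢ` monotone, `→ ∞` and (o) SUBLINEAR `Rᵢ τ / τ → 0`
(honest WLOG; the proof architecture needs it — W17 §5.3); (iii-bdd) the BOUNDED far rest shell `Rᵢ(σ−s₀)−W ≤ radiusᵢ ≤ Rᵢ σ`
lies eventually in the radiation zone (the r4 UNBOUNDED shell is boost-dishonest: it forces isochronous motions, PROVED by
`recutJunction_noTilt`/`recutJunction_isochronous`, p146718/p146630); (iii-c) eventually in lab time, every lab-slab coordinate
outside the flat domain is deep in some hole's certified tube (the coordinate form of what (ii) forces in honest geometries,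
W17 §3.5/§5.3); (a_R) a hole chart and the flat chart AGREE at doubly-late (rest-late and lab-late) CERTIFIED common coordinates
and (b_R) certified rest-late hole coordinates have no lab-late flat doubles (restricted to certified coordinates: over ALL
doubly-late coordinates they are topologically unsatisfiable for `N ≥ 2` pre-formed binaries, W17 §6); (ii) exhaustiveness of
the self-determined d.o.c. `O ∩ I⁻(docCharted d)` by the d.o.c.-certified slabs, as in r4. Honest for Kerr's own development
and for the honestly boosted single hole / receding multi-hole pictures (W17 §2–§5, elaboration probe
`work/stubs/w17/CurrencyProbe.lean`). (ref: DafermosLuk2017, Conjecture 1 (b)–(c); Klainerman2025, §1.1.1)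
[cite: DafermosLuk2017, Conjecture 1 (b)–(c)] -/
def HasExhaustiveDocChartsB (𝒟 : VacuumCauchyDevelopment D) {O : Set 𝒟.carrier} {k : ℕ}
    (d : StationaryFinalStateDecomposition 𝒟.toSpacetime O k) : Prop :=
  ∃ R : Fin d.N → ℝ → ℝ,
    (∀ i, Tendsto (fun τ ↦ 𝒟.toSpacetime.truncDeviationCk (d.background i) (d.toOver.chart i) k (R i τ) τ)
      atTop (𝓝 0)) ∧
    (∀ i, Monotone (R i)) ∧ (∀ i, Tendsto (R i) atTop atTop) ∧
    (∀ i, Tendsto (fun τ ↦ R i τ / τ) atTop (𝓝 0)) ∧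
    (∀ i, ∀ W s₀ : ℝ, ∀ᶠ σ in atTop,
      d.toOver.chart i '' ({x | (d.background i).time x.1 = σ ∧ R i (σ - s₀) - W ≤ (d.background i).radius x.1 ∧
        (d.background i).radius x.1 ≤ R i σ} ∩ docPart d i) ⊆ d.toOver.radiationZone) ∧
    (∀ W s₀ : ℝ, ∀ᶠ τ in atTop, ∀ y : E4, y 0 = τ → y ∉ (d.toOver.flatDomain : Set E4) →
      ∃ i, (d.background i).radius y ≤ R i ((d.background i).time y - s₀) - W) ∧
    (∀ (i : Fin d.N) (y : (d.background i).domain) (h : (y : E4) ∈ d.toOver.flatDomain),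
      d.toOver.τ₀ < (d.background i).time y.1 → d.toOver.τ₀ < (y : E4) 0 →
        (d.background i).radius y.1 ≤ R i ((d.background i).time y.1) →
          d.toOver.chart i y = d.toOver.flatChart ⟨y, h⟩) ∧
    (∀ (i : Fin d.N) (y : (d.background i).domain) (y' : d.toOver.flatDomain),
      d.toOver.τ₀ < (d.background i).time y.1 → (d.background i).radius y.1 ≤ R i ((d.background i).time y.1) →
        d.toOver.τ₀ < (y' : E4) 0 → d.toOver.chart i y = d.toOver.flatChart y' → (y : E4) = y') ∧
    ∀ τ₁ : ℝ, d.toOver.τ₀ < τ₁ →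
      (O ∩ 𝒟.metric.chronologicalPast 𝒟.timeOrientation (docCharted d)) \ docCertifiedLate d R τ₁ ⊆
        𝒟.metric.causalPast 𝒟.timeOrientation (docCertifiedSlab d R τ₁)

/-- **The `R`-free chart-overlap clauses** (m4 → m5, W15/W17): (e⁺) late flat coordinates are d.o.c.-part coordinates of every
hole; (e′) the excision radii tend to `∞`; (ℓ) eventually in lab time, coordinates within the excision scale of hole `i` are
rest-late for hole `i` (honest because `ρᵢ = o(t)`); (n′) two-sided horizon normalisation: late COLLAR images (late chart points
off the d.o.c. part) do not causally precede the radiation zone. The m4 clauses (hh), (bb) are dropped (unused by every landed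
brick, dishonest for `N ≥ 2`). (ref: DafermosLuk2017, §1.2.1; Klainerman2025, §1.1.1) [cite: DafermosLuk2017, §1.2.1] -/
def IsChartOverlapCompatibleB (𝒟 : VacuumCauchyDevelopment D) {O : Set 𝒟.carrier} {k : ℕ}
    (d : StationaryFinalStateDecomposition 𝒟.toSpacetime O k) : Prop :=
  (∀ y : d.toOver.flatDomain, d.toOver.τ₀ < (y : E4) 0 → ∀ i : Fin d.N,
      ∃ h : (y : E4) ∈ (d.background i).domain, (⟨(y : E4), h⟩ : (d.background i).domain) ∈ docPart d i) ∧
  (∀ i : Fin d.N, Tendsto (d.toOver.excision i) atTop atTop) ∧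
  (∀ i : Fin d.N, ∃ T : ℝ, ∀ y : (d.background i).domain, T < (y : E4) 0 →
      (d.background i).radius y.1 ≤ d.toOver.excision i ((y : E4) 0) + 1 → d.toOver.τ₀ < (d.background i).time y.1) ∧
  ∀ (i : Fin d.N) (x : (d.background i).domain), x ∈ (d.background i).lateRegion d.toOver.τ₀ → x ∉ docPart d i →
      d.toOver.chart i x ∉ 𝒟.metric.causalPast 𝒟.timeOrientation d.toOver.radiationZone

end Orientation

/-- **"Every MGHD of `D` settles down to regular stationary vacuum holes with property `Q`", T2 form** — the r4/r5
currency `SettlesDocWith' Q` (complete `𝓘⁺`; a `C²` stationary decomposition of the honest exterior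
`O = exteriorOf 𝒟 d.charted`, exhaustive in the d.o.c. sense (m5: `HasExhaustiveDocChartsB`), horizon-normalised; regular
Kerr-chartable holes in the telescope, `I⁺`-regular, with property `Q`) PLUS the two clauses of the re-typed summit, as
hypotheses on the settling geometry: every future-complete normalised null ray from the data stays in the closure of the
self-determined d.o.c. `O ∩ I⁻(docCharted d)` (`RaysStayInClosure`), the charts respect the time orientations
(`IsOrientationCompatible`) and (m4/m5) are restrictions of one injective lab chart on the doubly-late certified coordinates:
`HasExhaustiveDocChartsB` (boost-honest exhaustiveness: sublinear radii, BOUNDED overlap shell, coordinate deepness, certified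
agreement clauses — replacing the r4 `HasExhaustiveDocCharts'`) and `IsChartOverlapCompatibleB` (the `R`-free clauses).
[cite: DafermosLuk2017, §1.2.1 and Conjecture 1] -/
def SettlesDocWithT2 (Q : StationaryAFBlackHole.{0} → Prop) (X : Type) [TopologicalSpace X]
    [ChartedSpace E3 X] [IsManifold (𝓡 3) ∞ X] [T2Space X] [SecondCountableTopology X]
    [ConnectedSpace X] (D : InitialDataSet (𝓡 3) X) : Prop :=
  ∀ 𝒟 : VacuumCauchyDevelopment D, 𝒟.IsMaximal →
    Summit.FinalStateConjecture.HasCompleteNullInfinity 𝒟.toCauchyDevelopment ∧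
      ∃ (O : Set 𝒟.carrier) (d : StationaryFinalStateDecomposition 𝒟.toSpacetime O 2),
        O = Summit.FinalStateConjecture.exteriorOf 𝒟.toCauchyDevelopment d.charted ∧
          HasExhaustiveDocChartsB 𝒟 d ∧ IsHorizonNormalised d ∧
            Summit.FinalStateConjecture.RaysStayInClosure 𝒟.toCauchyDevelopment
              (O ∩ 𝒟.metric.chronologicalPast 𝒟.timeOrientation (docCharted d)) ∧
              IsOrientationCompatible 𝒟 d ∧ IsChartOverlapCompatibleB 𝒟 d ∧
                ∀ i, (d.hole i).horizon ⊆ Set.range (d.adapted i).toFun ∧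
                  ChartIsAsymptoticallyCartesian (d.adapted i) ∧
                    ChartIsAsymptoticallySchwarzschildean' (d.adapted i) ∧
                      InTelescope (d.hole i) ∧ (d.hole i).IsIPlusRegular ∧ Q (d.hole i)

/-! ## §1 The restated / new stub statements of reshape r7 (precise `Prop`s `Sig7.stub_<name>`; inlined copy) -/

/-- **Stub 1R-F5 · `kerrIdentificationFuture` (NEW, classical, re-type-forced)** — the Kerr identification of a telescope
hole is future-preserving: if `Θ` is a `T`-equivariant (`Θ(x + s e₀) = Θ x + (c s) e₀`, `c > 0`) isometric identification
of the Kerr exterior `(Kerr.exterior M a, Kerr.bilin M a)` with the d.o.c. part of the adapted chart `A`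
(`IsKerrChartedWith`), then at every point of the Kerr exterior the push-forward by `A ∘ Θ` of Kerr's future timelike
field `V_{M,a} = −g♯(dt*)` (`Kerr.timeVector`) is future-directed for `𝓑`. WHY TRUE: `dA(e₀) = T` is future timelike on
`M_ext ⊆ doc` (structure field `isStationary`), so at a point of `Θ⁻¹(A⁻¹ M_ext)` the `A`-timelike vectors `dΘ(V)` and
`dΘ(e₀) = c e₀` lie in one cone (`g_{M,a}(V, e₀) = −1`, `Θ` isometric), whence `dA(dΘ V)` is future there; a continuous
nowhere-null timelike field on the connected `Kerr.exterior` cannot change cone. SIZE: M. (ref: ONeill1983, Ch. 5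
Lemma 5.26 ff.; ChruscielCosta2008, §2.2) -/
def Sig7.stub_kerrIdentificationFuture : Prop :=
  ∀ (𝓑 : StationaryAFBlackHole.{0}) (A : 𝓑.AdaptedChart) (M a c r₀ : ℝ) (Θ : E4 → E4),
    InTelescope 𝓑 → IsKerrChartedWith 𝓑 A M a c r₀ Θ →
      ∀ u ∈ (Kerr.exterior M a : Set E4), ∀ h : Θ u ∈ A.domain,
        𝓑.timeOrientation.IsFutureDirected
          (mfderiv 𝓘(ℝ, E4) (𝓡 4) A.toFun ⟨Θ u, h⟩ (fderiv ℝ Θ u (Kerr.timeVector M a u)))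

/-- **Stub 4-residuals (r7 registration device)** — the two obligations left of stub 4 (`Sig.stub_moncriefFacts`, via the
wave-3 reduction `stub_moncriefFacts_of_facts`, p124620): the CITED Literature fact
`ChruscielDelay_localConstraintDeformation` (local constraint deformation off germ-KIDs; Chruściel–Delay 2003 Thm. 5.9 /
Corvino–Schoen 2006 — a literature debt, closed by its `_holds` theorem and by nothing else) ∧ the localised Moncrief
annihilator lemma in single-detector form (`LocalSingleDetectionAt`, the r6 worker residual). (ref: ChruscielDelay2003,
Thm. 5.9; Moncrief1975, §IV) -/
def Sig7.stub_moncriefResiduals : Prop :=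
  Literature.Geometry.Lorentzian.ChruscielDelay_localConstraintDeformation ∧
    ∀ (X : Type) [TopologicalSpace X] [ChartedSpace E3 X] [IsManifold (𝓡 3) ∞ X] [T2Space X]
      [SecondCountableTopology X] [ConnectedSpace X] (D : InitialDataSet (𝓡 3) X)
      (𝒟 : VacuumCauchyDevelopment D) (x₀ : X), LocalSingleDetectionAt 𝒟 x₀

/-! ## §1M The re-typed stubs of this crux (NEW statements; precise `Prop`s `SigM.stub_<name>`): the two FRONT stubs in the ModT currency, and (m2) the oriented junction core -/

/-- **Stub 2′ · `nonSettlingCureRel` (m6: the global half RELATIVE TO CENSORSHIP, LEAD; open problem)** — the m1–m5 stub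
`nonSettlingCureModT` with the censorship-escape CURVE handed in (crux-strategist s1, `STRATEGY-CENSUS.md` §Decomposition (c),
alt line `Lines/wcc_relative_split.lean`): for an admissible datum `D` that does not settle presentably or settles with a local
Killing germ at every point, AND every tame curve `F` of admissible data through `D` (immersed at `0` and injective, or constant)
whose members off `0` are CENSORED (an MGHD exists and every MGHD has complete `𝓘⁺`), a tame immersed injective admissible curve
`F'` through `D` whose members off `0` settle presentably to MODE-STABLE holes. Weak cosmic censorship (tame, MGHD form — the
shared item stmt-FinalStateConjecture-17269 `PhaseMixingCapture.WeakCosmicCensorshipTame`, cited BY NAME in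
`FinalStateFromKerrOrBomb_of` as `MGHDExists` is) now supplies those curves, entering the generic conclusion along its witness
curves (`InitialDataSet.isTameChristodoulouGeneric_of_relative_exceptional`, TameGenericityDiagonal.lean) — never by conjunction
(∧-non-closure, `Theorems/CaptureSufficesTame/Negative/TameGenericityAndFails.lean`). Strictly weaker than m5's 2′ (more
hypotheses); the uncensored case is gone; the curve branch (upgrade a censorship-escape curve to a final-state-escape curve, spiral
obstruction at oscillatory bombs included) is explicit. The m5 text follows for the record.
**(m5 docstring)** data that do not settle PRESENTABLY — i.e. fail
`SettlesDocWithT2 InTelescopeModT` (every MGHD has complete `𝓘⁺` and a `C²` stationary decomposition of its honest exterior, exhaustive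
in the d.o.c. sense, horizon-normalised, complete rays in the closure of the self-determined d.o.c., orientation-compatible charts,
with regular Kerr-chartable holes of the rev-4 telescope which are `I⁺`-regular AND lie in the rev-6 telescope of `KerrOrBombModT`:
future-presented, simply connected d.o.c., Killing–timelike collar, belt compact mod `T`) —, or that settle with an MGHD carrying a
local Killing germ at EVERY point of the slice, are curable by a witness curve of the re-typed genericity: an end `e`, a family `F`
tame on `e`, immersed at `0`, injective, admissible, `F 0 = D`, all of whose members off `0` settle presentably to MODE-STABLE holes
(`SettlesDocWithT2 ModeStableModT`). Contains: weak cosmic censorship in Christodoulou's instability form, large-data settling, a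
dynamical third law, `I⁺`-regularity and presentability of the limits (future-presentation is WLOG by the landed re-presentation S1b,
p115302; `π₁(doc) = 0` by topological censorship; the collar by smooth local rigidity near a non-degenerate horizon; the belt by AF +
`I⁺`-regularity), the two T2 clauses, the curing of symmetric exceptional data, and — through `ModeStable` of the cured limits —
the genericity of scalar mode stability. Kept as ONE curve statement (predecessor Disproof §5: ∧-non-closure of curve genericity).
(ref: DafermosLuk2017, §1.2.1 and Conjecture 1; Christodoulou1999, p. A24; ChruscielCosta2008, Def. 1.1) -/
def SigM.stub_nonSettlingCureRel : Prop :=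
  ∀ (X : Type) [TopologicalSpace X] [ChartedSpace E3 X] [IsManifold (𝓡 3) ∞ X]
    [T2Space X] [SecondCountableTopology X] [ConnectedSpace X],
    ∀ D ∈ admissibleVacuumData X,
      (¬ SettlesDocWithT2 InTelescopeModT X D ∨
        ∃ 𝒟 : VacuumCauchyDevelopment D, 𝒟.IsMaximal ∧ ∀ x : X, ¬ IsKIDFreeAt 𝒟 x) →
      ∀ (e : AFEnd X) (F : EuclideanSpace ℝ (Fin 1) → InitialDataSet (𝓡 3) X),
        InitialDataSet.IsTameDataFamily e 1 F →
        ((InitialDataSet.IsImmersedAtZero 1 F ∧ Function.Injective F) ∨ ∀ c, F c = F 0) →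
        (∀ c, F c ∈ admissibleVacuumData X) → F 0 = D →
        (∀ c : EuclideanSpace ℝ (Fin 1), c ≠ 0 →
          (∃ 𝒟 : VacuumCauchyDevelopment (F c), 𝒟.IsMaximal) ∧
            ∀ 𝒟 : VacuumCauchyDevelopment (F c), 𝒟.IsMaximal →
              Summit.FinalStateConjecture.HasCompleteNullInfinity 𝒟.toCauchyDevelopment) →
      ∃ (e' : AFEnd X) (F' : EuclideanSpace ℝ (Fin 1) → InitialDataSet (𝓡 3) X),
        InitialDataSet.IsTameDataFamily e' 1 F' ∧ InitialDataSet.IsImmersedAtZero 1 F' ∧ F' 0 = D ∧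
          Function.Injective F' ∧ (∀ c, F' c ∈ admissibleVacuumData X) ∧
            ∀ c : EuclideanSpace ℝ (Fin 1), c ≠ 0 → SettlesDocWithT2 ModeStableModT X (F' c)

/-- **Stub 5′ · `dualModeEjectionModT` (genericity transfer at a bomb; XL)** — r7's stub 5 in the ModT currency: for an admissible `D`,
an MGHD with complete `𝓘⁺` and a `C²` stationary decomposition in the T2 d.o.c. sense whose holes are regular, `I⁺`-regular and
PRESENTABLE in the rev-6 telescope (`InTelescopeModT`), whose hole `i` carries a growing GRAVITATIONAL Killing-mode pair, and which has
a germ-KID-free point: there are a germ-KID-free point `x₀` and finitely many symmetric detectors at `x₀` such that every jointly smooth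
admissible `k`-family `G` through `D` supported in the chart source at `x₀` with non-degenerate pairing matrix contains a jointly
smooth curve `F` (`F c = G c'`), immersed at `0`, injective on a window `‖c‖ < ε`, all of whose members `0 < ‖c‖ < ε` settle
presentably to MODE-STABLE holes (`SettlesDocWithT2 ModeStableModT`). Tameness of `F` is not asked (compact support,
`isTameDataFamily_restrict_of_agree_off_compact_one`). Debts as for r7 stub 5 (dual-mode transport by the conserved symplectic current,
local non-gauge-ness of the dual mode, the saddle, the fate of the explosion) PLUS the spiral obstruction of `Ideas/sweep-or-lock.md`
(`spiral_crossing`: transverse one-parameter designs at an oscillatory bomb meet every downstream codimension-1 stratum at parameters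
`→ 0`; evasion by flat phase-locked designs). (ref: DafermosLuk2017, §1.2.1; Christodoulou1999, p. A24; Moncrief1975, §IV) -/
def SigM.stub_dualModeEjectionModT : Prop :=
  ∀ (X : Type) [TopologicalSpace X] [ChartedSpace E3 X] [IsManifold (𝓡 3) ∞ X]
    [T2Space X] [SecondCountableTopology X] [ConnectedSpace X],
    ∀ D ∈ admissibleVacuumData X, ∀ (𝒟 : VacuumCauchyDevelopment D), 𝒟.IsMaximal →
      Summit.FinalStateConjecture.HasCompleteNullInfinity 𝒟.toCauchyDevelopment →
      ∀ (O : Set 𝒟.carrier) (d : StationaryFinalStateDecomposition 𝒟.toSpacetime O 2),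
        O = Summit.FinalStateConjecture.exteriorOf 𝒟.toCauchyDevelopment d.charted →
        HasExhaustiveDocChartsB 𝒟 d → IsHorizonNormalised d →
        Summit.FinalStateConjecture.RaysStayInClosure 𝒟.toCauchyDevelopment
          (O ∩ 𝒟.metric.chronologicalPast 𝒟.timeOrientation (docCharted d)) →
        IsOrientationCompatible 𝒟 d →
        (∀ i, (d.hole i).horizon ⊆ Set.range (d.adapted i).toFun ∧
          ChartIsAsymptoticallyCartesian (d.adapted i) ∧
            ChartIsAsymptoticallySchwarzschildean' (d.adapted i) ∧
              InTelescope (d.hole i) ∧ (d.hole i).IsIPlusRegular ∧ InTelescopeModT (d.hole i)) →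
        ∀ (i : Fin d.N) (ν ϖ : ℝ) (h₁ h₂ : HoleBilinField (d.hole i)), 0 < ν →
          IsGravitationalModePair (d.hole i) (d.adapted i) ν ϖ h₁ h₂ →
          (∃ x : X, IsKIDFreeAt 𝒟 x) →
          ∃ (x₀ : X) (k : ℕ) (A B : Fin k → BilinField X), AreSymmDetectorsAt 𝒟 x₀ A B ∧
            ∀ G : EuclideanSpace ℝ (Fin k) → InitialDataSet (𝓡 3) X,
              InitialDataSet.IsSmoothDataFamily k G → G 0 = D → (∀ c, G c ∈ admissibleVacuumData X) →
              (∃ K : Set X, IsCompact K ∧ K ⊆ (extChartAt (𝓡 3) x₀).source ∧ IsSupportedIn D G K) →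
              (pairingMatrix D x₀ A B G).det ≠ 0 →
              ∃ (ε : ℝ) (F : EuclideanSpace ℝ (Fin 1) → InitialDataSet (𝓡 3) X), 0 < ε ∧
                InitialDataSet.IsSmoothDataFamily 1 F ∧ InitialDataSet.IsImmersedAtZero 1 F ∧ F 0 = D ∧
                (∀ c, ∃ c', F c = G c') ∧
                (∀ c c' : EuclideanSpace ℝ (Fin 1), ‖c‖ < ε → ‖c'‖ < ε → F c = F c' → c = c') ∧
                ∀ c : EuclideanSpace ℝ (Fin 1), c ≠ 0 → ‖c‖ < ε → SettlesDocWithT2 ModeStableModT X (F c)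

/-- **Stub 1G-core, BOOST-HONEST (reshape m5)** — binders = the m4 core's with (iii) replaced by (o) sublinear radii, (iii-bdd) the
BOUNDED overlap shell, (iii-c) coordinate deepness, and the eight m4 overlap binders replaced by (a_R), (b_R) (certified
coordinates) and (e⁺), (e′), (ℓ), (n′); conclusion VERBATIM (restricted LHS). WHY m5: the m4 core was PROVED (wave 5, W16: ten
accepted bricks + kernel-checked glue `evidence-W16-ComposeCheck.lean`) — but only because the m4 binders provably force
ISOCHRONOUS motions (`Λᵢ e₀ = e₀`, p146718 + p146630, from the r4 UNBOUNDED shell (iii)), i.e. the m4 currency certified no boosted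
hole and was dishonest for `N ≥ 2` receding endstates; the wave-6 boost audit (W17, `evidence-W17-boost-audit.md`, verdict V1)
shows rest-time/lab-time slab mixing is boost-honest, fixes the currency as above, and gives the boost-general proof plan
(proportional level shift `τ₂ := τ₁/(2γ_max)`, steps 0/T/F, brick ledger: (α) p141608 p141985 p142035, IVT p142043, flat lines
p143586, `c = 1` p144329, (HTF) p149111, Lorentz sandwich p152127 SURVIVE; flat steering p146004, assembly p146623, (NH) p149108
re-proved without isochrony). STATUS (end of the lead's session 4): **PROVED MODULO THE FARM BUILD** — waves 7–8 landed the
boost-general bricks p153600 (Lorentz/lab-time, orthochrony), p153924, p154132 (dichotomy, slab membership), p154085 (far-flat),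
p153531 (NH′), p156089 + p156202 (Step F `recutJunction_flatSteer_boost`), p156218 (assembly `recutJunctionCoreB_of_bricks`, hypotheses
= the registered brick texts, conclusion = this def's body verbatim; composition kernel-checked, `work/stubs/w21/ComposeCheck.lean`);
the closer `recutJunctionCoreB_holds` (registered) is proposed as p156763 and waits only on the farm build of the brick modules.
History of the m4 text follows.
**(m4 docstring)** Stub 1G-core over the CHART-OVERLAP CLAUSE — the oriented junction core of m2/m3 was REFUTED AS TYPED by the
wave-4 worker W15 (evidence `evidence-W15-core-false.md`: N = 1 exact Schwarzschild, honest hole side, flat chart TIME-RELABELLED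
`Ψ₀(φ, y) = KS(φ + 10 log₁₀ φ, y)` — legal since `G' → 1` in `C²` —, staircase radii `R`, spiked sublinear excision; every binder
incl. `HasExhaustiveDocCharts'` (ii), (iii) holds and the inclusion fails at `τ₁ = G⁻¹(100ⁿ)` for every `n`). Root cause:
`StationaryFinalStateDecomposition` has no flat/hole chart-transition clause, so flat time and hole-chart time of common EVENTS are
unrelated. Repair (this def): the SAME binders, then the eight Θ-free clauses of `IsChartOverlapCompatible 𝒟 d` (now part of the
settling currency `SettlesDocWithT2`) UNFOLDED as binders — (a) hole/flat charts agree at doubly-late coordinates, (hh) hole/hole,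
(b), (bb) no double coordinates, (e⁺) late flat coordinates are d.o.c.-part coordinates of every hole, (e′) excision radii `→ ∞`,
(ℓ) lab-late coordinates within the excision scale are eventually rest-late, (n′) late collar images do not causally precede the
radiation zone —, and the conclusion with its left-hand side intersected with the self-determined d.o.c.
`O ∩ I⁻(docCharted d)` (harmless for the consumer: `recut_ii_of_core_at'` below applies the core only at points of
`O' ⊆ O ∩ I⁻(docCharted d)`; it is what lets clause (ii) at a shifted level replace curve tracking from early points).
LANDED TOWARDS IT (all `--supports` 17839, modules unbuilt): ingredient (α) — Kerr–Schild time lines / helical `Kerr.drsrVector`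
lines in certified hole tubes are future timelike, far tube points reach the recut slab (p141608, p141985, p142035), the
entry-point/IVT brick (p142043), flat time lines ⇒ `J⁻(flat slab)` (p143586), (iii)+(b) ⇒ shell coordinates are flat-domain
points (p143903), `c = 1` inside the core (p144329), and the now-moot reduction of the m3 core to the past-boundary property
(p141631). OPEN (W15 plan + residual): boost-aware steering of radiation-zone events by their FLAT coordinates, chart switch at
excision entries via (a)+(ℓ), the near-horizon step (NH) via (n′) + `IsHorizonNormalised`, and ≈ 400 lines of assembly.
PLANNER FLAG: `HasExhaustiveDocCharts'` (iii) (UNBOUNDED far rest-shells inside the radiation zone) is satisfiable for BOOSTED holes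
only by contorting the metrically unconstrained lab-early back sides of the hole charts; a boost-compatible (iii) bounds the shell
above (`radius ≤ R σ`) — only this core consumes (iii). SIZE: L/XL (unprinted bookkeeping). (ref: DafermosLuk2017, Conjecture 1 (b)–(c)) -/
def SigM.stub_recutJunctionCoreB : Prop :=
  ∀ (X : Type) [TopologicalSpace X] [ChartedSpace E3 X] [IsManifold (𝓡 3) ∞ X]
    [T2Space X] [SecondCountableTopology X] [ConnectedSpace X] (D : InitialDataSet (𝓡 3) X)
    (𝒟 : VacuumCauchyDevelopment D) (O : Set 𝒟.carrier)
    (d : StationaryFinalStateDecomposition 𝒟.toSpacetime O 2)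
    (M a c r₀ : Fin d.N → ℝ) (Θ : Fin d.N → E4 → E4) (R : Fin d.N → ℝ → ℝ),
    O = Summit.FinalStateConjecture.exteriorOf 𝒟.toCauchyDevelopment d.charted →
    (∀ i, Tendsto (fun τ ↦ 𝒟.toSpacetime.truncDeviationCk (d.background i) (d.toOver.chart i) 2 (R i τ) τ)
      atTop (𝓝 0)) →
    (∀ i, Monotone (R i)) → (∀ i, Tendsto (R i) atTop atTop) →
    (∀ i, Tendsto (fun τ ↦ R i τ / τ) atTop (𝓝 0)) →
    (∀ i, ∀ W s₀ : ℝ, ∀ᶠ σ in atTop,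
      d.toOver.chart i '' ({x | (d.background i).time x.1 = σ ∧ R i (σ - s₀) - W ≤ (d.background i).radius x.1 ∧
        (d.background i).radius x.1 ≤ R i σ} ∩ docPart d i) ⊆ d.toOver.radiationZone) →
    (∀ W s₀ : ℝ, ∀ᶠ τ in atTop, ∀ y : E4, y 0 = τ → y ∉ (d.toOver.flatDomain : Set E4) →
      ∃ i, (d.background i).radius y ≤ R i ((d.background i).time y - s₀) - W) →
    (∀ τ₁ : ℝ, d.toOver.τ₀ < τ₁ →
      (O ∩ 𝒟.metric.chronologicalPast 𝒟.timeOrientation (docCharted d)) \ docCertifiedLate d R τ₁ ⊆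
        𝒟.metric.causalPast 𝒟.timeOrientation (docCertifiedSlab d R τ₁)) →
    IsHorizonNormalised d →
    (∀ i, (d.hole i).horizon ⊆ Set.range (d.adapted i).toFun ∧
      ChartIsAsymptoticallyCartesian (d.adapted i) ∧ InTelescope (d.hole i)) →
    (∀ i, IsKerrChartedWith (d.hole i) (d.adapted i) (M i) (a i) (c i) (r₀ i) (Θ i)) →
    (∀ i, ∀ u ∈ (Kerr.exterior (M i) (a i) : Set E4), ∀ h : Θ i u ∈ (d.adapted i).domain,
      (d.hole i).timeOrientation.IsFutureDirected
        (mfderiv 𝓘(ℝ, E4) (𝓡 4) (d.adapted i).toFun ⟨Θ i u, h⟩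
          (fderiv ℝ (Θ i) u (Kerr.timeVector (M i) (a i) u)))) →
    (∀ (i : Fin d.N) (y : (d.background i).domain) (w : E4), d.toOver.τ₀ < (d.background i).time y.1 →
      (d.hole i).timeOrientation.IsFutureDirected
          (mfderiv 𝓘(ℝ, E4) (𝓡 4) (d.adapted i).toFun
            ⟨poincareInv (d.motion i).1 (d.motion i).2 y.1, ModelBackground.mem_boost_domain.1 y.2⟩
            (((d.motion i).1 : E4 ≃L[ℝ] E4).symm w)) →
        𝒟.metric.IsTimelike (mfderiv 𝓘(ℝ, E4) (𝓡 4) (d.toOver.chart i) y w) →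
          𝒟.timeOrientation.IsFutureDirected (mfderiv 𝓘(ℝ, E4) (𝓡 4) (d.toOver.chart i) y w)) →
    (∀ y : d.toOver.flatDomain, d.toOver.τ₀ < (y : E4) 0 →
      𝒟.metric.IsTimelike (mfderiv 𝓘(ℝ, E4) (𝓡 4) d.toOver.flatChart y (E4.basisVector 0)) →
        𝒟.timeOrientation.IsFutureDirected (mfderiv 𝓘(ℝ, E4) (𝓡 4) d.toOver.flatChart y (E4.basisVector 0))) →
    (∀ (i : Fin d.N) (y : (d.background i).domain) (h : (y : E4) ∈ d.toOver.flatDomain),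
      d.toOver.τ₀ < (d.background i).time y.1 → d.toOver.τ₀ < (y : E4) 0 →
        (d.background i).radius y.1 ≤ R i ((d.background i).time y.1) →
          d.toOver.chart i y = d.toOver.flatChart ⟨y, h⟩) →
    (∀ (i : Fin d.N) (y : (d.background i).domain) (y' : d.toOver.flatDomain),
      d.toOver.τ₀ < (d.background i).time y.1 → (d.background i).radius y.1 ≤ R i ((d.background i).time y.1) →
        d.toOver.τ₀ < (y' : E4) 0 → d.toOver.chart i y = d.toOver.flatChart y' → (y : E4) = y') →
    (∀ y : d.toOver.flatDomain, d.toOver.τ₀ < (y : E4) 0 → ∀ i : Fin d.N,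
      ∃ h : (y : E4) ∈ (d.background i).domain, (⟨(y : E4), h⟩ : (d.background i).domain) ∈ docPart d i) →
    (∀ i : Fin d.N, Tendsto (d.toOver.excision i) atTop atTop) →
    (∀ i : Fin d.N, ∃ T : ℝ, ∀ y : (d.background i).domain, T < (y : E4) 0 →
      (d.background i).radius y.1 ≤ d.toOver.excision i ((y : E4) 0) + 1 → d.toOver.τ₀ < (d.background i).time y.1) →
    (∀ (i : Fin d.N) (x : (d.background i).domain), x ∈ (d.background i).lateRegion d.toOver.τ₀ → x ∉ docPart d i →
      d.toOver.chart i x ∉ 𝒟.metric.causalPast 𝒟.timeOrientation d.toOver.radiationZone) →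
    ∃ s₁ : ℝ, ∀ s W : ℝ, s₁ ≤ s → s₁ ≤ W → ∃ τJ : ℝ, ∀ τ₁ : ℝ, τJ < τ₁ →
      ((𝒟.metric.causalPast 𝒟.timeOrientation (docHoleSlabs d R τ₁) ∪ docHoleTubes d R τ₁) ∩
          (O ∩ 𝒟.metric.chronologicalPast 𝒟.timeOrientation (docCharted d))) \
          recutCertifiedLate d M a Θ (fun i τ ↦ R i (c i * τ - s) - W) τ₁ ⊆
        𝒟.metric.causalPast 𝒟.timeOrientation
          (recutCertifiedSlab d M a Θ (fun i τ ↦ R i (c i * τ - s) - W) τ₁)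

/-- **Stub 1R-F3 (m3 registration device)** — `KerrHorizonExtension` (p125844 statement, …KerrIsometryRigidityWave3Facts.lean) by
name. (ref: ChruscielCosta2008, Thm. 1.3 with §4.3 Thm. 4.11) -/
def SigM.stub_kerrHorizonExtension : Prop :=
  KerrHorizonExtension

/-- **Stub 1R-F4 (m3 registration device)** — `KerrAsymptoticRigidity` (p125844 statement, …KerrIsometryRigidityWave3Facts.lean)
by name. (ref: Bartnik1986, §3 Cor. 3.2; ChruscielCosta2008, §2.1) -/
def SigM.stub_kerrAsymptoticRigidity : Prop :=
  KerrAsymptoticRigidity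

/-! ### Read-backs and monotonicity of the inlined currency (sorry-free) -/

/-- Read-back of `InTelescopeModT` against the target: `KerrOrBombModT` says exactly that a hole of the rev-6 telescope which is
Killing-mode-stable is a (fact-free) sub-extremal Kerr exterior — the DOCK of this line, pure logic (instances: the tree's
`hasLeviCivita`, `kerrFacts`; `IsKillingModeStable` is the mode-stability clause by `Iff.rfl`). [folklore] -/
theorem isKerrExterior_of_kerrOrBombModT (hX : KerrOrBombModT) (𝓑 : StationaryAFBlackHole.{0})
    (hT : InTelescopeModT 𝓑) (hms : ModeStable 𝓑) : IsKerrExterior 𝓑 := by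
  haveI : 𝓑.metric.HasLeviCivita := 𝓑.metric.toPseudoRiemannianMetric.hasLeviCivita
  haveI : Kerr.Facts := kerrFacts
  obtain ⟨hRic, hreg, hfut, hT0, hsc, U, K, hUo, hHU, hconn, hKs, hKill, hcomm, hne, htan, hcollar, hbelt⟩ := hT
  exact hX 𝓑 hRic hreg hfut hT0 hsc U K hUo hHU hconn hKs hKill hcomm hne htan hcollar hbelt
    ((𝓑.isKillingModeStable_iff).mp hms)

/-- `ModeStableModT` holes are in the rev-6 telescope. [folklore] -/
theorem ModeStableModT.inTelescopeModT {𝓑 : StationaryAFBlackHole.{0}} (h : ModeStableModT 𝓑) : InTelescopeModT 𝓑 :=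
  h.1

/-- `ModeStableModT` holes are Killing-mode-stable. [folklore] -/
theorem ModeStableModT.modeStable {𝓑 : StationaryAFBlackHole.{0}} (h : ModeStableModT 𝓑) : ModeStable 𝓑 :=
  h.2

/-- Read-back of `SettlesDocWithT2` (definitional). [folklore] -/
theorem settlesDocWithT2_iff : ∀ (Q : StationaryAFBlackHole.{0} → Prop) (X : Type) [TopologicalSpace X] [ChartedSpace E3 X] [IsManifold (𝓡 3) ∞ X] [T2Space X] [SecondCountableTopology X] [ConnectedSpace X] (D : InitialDataSet (𝓡 3) X), SettlesDocWithT2 Q X D ↔ ∀ 𝒟 : VacuumCauchyDevelopment D, 𝒟.IsMaximal → Summit.FinalStateConjecture.HasCompleteNullInfinity 𝒟.toCauchyDevelopment ∧ ∃ (O : Set 𝒟.carrier) (d : StationaryFinalStateDecomposition 𝒟.toSpacetime O 2), O = Summit.FinalStateConjecture.exteriorOf 𝒟.toCauchyDevelopment d.charted ∧ HasExhaustiveDocChartsB 𝒟 d ∧ IsHorizonNormalised d ∧ Summit.FinalStateConjecture.RaysStayInClosure 𝒟.toCauchyDevelopment (O ∩ 𝒟.metric.chronologicalPast 𝒟.timeOrientation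 (docCharted d)) ∧ IsOrientationCompatible 𝒟 d ∧ IsChartOverlapCompatibleB 𝒟 d ∧ ∀ i, (d.hole i).horizon ⊆ Set.range (d.adapted i).toFun ∧ ChartIsAsymptoticallyCartesian (d.adapted i) ∧ ChartIsAsymptoticallySchwarzschildean' (d.adapted i) ∧ InTelescope (d.hole i) ∧ (d.hole i).IsIPlusRegular ∧ Q (d.hole i) :=
  fun _ _ _ _ _ _ _ _ _ ↦ Iff.rfl

/-- `SettlesDocWithT2` is monotone in the hole property (used by the skeleton's `exists_bomb_docT2`). [folklore] -/
theorem settlesDocWithT2_mono : ∀ (Q Q' : StationaryAFBlackHole.{0} → Prop) (X : Type) [TopologicalSpace X] [ChartedSpace E3 X] [IsManifold (𝓡 3) ∞ X] [T2Space X] [SecondCountableTopology X] [ConnectedSpace X] (D : InitialDataSet (𝓡 3) X), (∀ 𝓑, Q 𝓑 → Q' 𝓑) → SettlesDocWithT2 Q X D → SettlesDocWithT2 Q' X D := by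
  intro Q Q' X _ _ _ _ _ _ D hQ h 𝒟 h𝒟
  obtain ⟨hcni, O, d, hO, hex, hnorm, hrays, hor, hco, hholes⟩ := h 𝒟 h𝒟
  exact ⟨hcni, O, d, hO, hex, hnorm, hrays, hor, hco, fun i ↦ ⟨(hholes i).1, (hholes i).2.1, (hholes i).2.2.1,
    (hholes i).2.2.2.1, (hholes i).2.2.2.2.1, hQ _ (hholes i).2.2.2.2.2⟩⟩


/-! ## §2 Registered stubs of shape m5 (`sorry` lives ONLY here; 7 = stubs_max: F3, F4, coreB, 2′-rel, 3, 4-residuals, 5′) -/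

/-- Stub 1R-F3 (m3, BACK): `C^∞` boundary regularity of the d.o.c. isometry at `𝓗⁺` + equivariant collar continuation
(`KerrHorizonExtension`, …KerrIsometryRigidityWave3Facts.lean; unprinted, XL). F5 is PROVED (p135232) and F4 is its own stub. -/
theorem stub_kerrHorizonExtension : SigM.stub_kerrHorizonExtension := by
  sorry

/-- **Registered stub 1R-F4** — PROVED modulo the farm build: 13 layers landed (p137926 … p141670), assembly verified
(`evidence-KerrAsymptoticRigidityAssembly.lean`), closer `kerrAsymptoticRigidity_holds : KerrAsymptoticRigidity` proposed as p156752
(pending farm; then `exact kerrAsymptoticRigidity_holds` here). -/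
theorem stub_kerrAsymptoticRigidity : SigM.stub_kerrAsymptoticRigidity := by
  sorry

/-- **Registered stub 1G-core (m5: boost-honest binders)** — PROVED modulo the farm build (closer `recutJunctionCoreB_holds`,
p156763 pending farm; then `exact recutJunctionCoreB_holds` here); see `SigM.stub_recutJunctionCoreB`; the m4 text
`stub_recutJunctionCoreCO` is PROVED modulo the farm build (W16) but only in the isochronous regime its binders force, and expires
with this reshape. -/
theorem stub_recutJunctionCoreB : SigM.stub_recutJunctionCoreB := by
  sorry

/-- Stub 2′ (m6, LEAD): the non-settling cure RELATIVE to censorship — open problem. -/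
theorem stub_nonSettlingCureRel : SigM.stub_nonSettlingCureRel := by
  sorry

/-- Stub 3 (XL, conjectural; statement landed in the Sig module): the Bridge — the stub that keeps X load-bearing. -/
theorem stub_probeUniversality : Sig.stub_probeUniversality := by
  sorry

/-- Stub 4-residuals (r7, BACK): the cited Chruściel–Delay fact ∧ the localised Moncrief annihilator lemma (p124620). -/
theorem stub_moncriefResiduals : Sig7.stub_moncriefResiduals := by
  sorry

/-- Stub 5′ (FRONT, XL): the dual modes detect at a germ-KID-free point; immersed steerable families escape (ModT currency). -/
theorem stub_dualModeEjectionModT : SigM.stub_dualModeEjectionModT := by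
  sorry

/-! ## §3 Glue lemmas (sorry-free) -/

section Glue

variable {X : Type} [TopologicalSpace X] [ChartedSpace E3 X] [IsManifold (𝓡 3) ∞ X]
  [T2Space X] [SecondCountableTopology X] [ConnectedSpace X]

/-- **F5 is a theorem** (p135232, `kerrIdentificationFuture`; inlined §L until the module builds). -/
theorem f5_discharged : Sig7.stub_kerrIdentificationFuture :=
  kerrIdentificationFuture

/-- **Stub 1R from F3 ∧ F4 alone** (r7): the wave-3 reduction `stub_kerrIsometryRigidity_of_extension_and_rigidity`
(p126702) with its three cited Kerr/Schwarzschild facts DISCHARGED by the tree's proofs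
(`ONeill1995_kerrKillingFields_holds`, `StephaniEtAl2003_schwarzschildKillingFields_holds` p129316,
`ONeill1995_kerrBackwardsIsometry_holds` p127724). -/
theorem kerrIsometryRigidity_of_F3_F4 (hHX : KerrHorizonExtension) (hAR : KerrAsymptoticRigidity) :
    Sig4.stub_kerrIsometryRigidity :=
  stub_kerrIsometryRigidity_of_extension_and_rigidity ONeill1995_kerrKillingFields_holds
    StephaniEtAl2003_schwarzschildKillingFields_holds ONeill1995_kerrBackwardsIsometry_holds hHX hAR

omit [T2Space X] [SecondCountableTopology X] in
/-- **Clause (ii) of the recut at one time from the RESTRICTED core** (m4 variant of `recut_ii_of_core_at`, p125072): the core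
is applied only at points of `O' ⊆ O ∩ I⁻(docCharted d)`, so its left-hand side may be intersected with that set. [folklore] -/
theorem recut_ii_of_core_at' {D : InitialDataSet (𝓡 3) X} (𝒟 : CauchyDevelopment D) {O : Set 𝒟.carrier} {k : ℕ}
    (d : StationaryFinalStateDecomposition 𝒟.toSpacetime O k) (M a : Fin d.N → ℝ) (Θ : Fin d.N → E4 → E4)
    (R R' : Fin d.N → ℝ → ℝ) {O' : Set 𝒟.carrier} (τ₁ : ℝ)
    (hO' : O' ⊆ O ∩ 𝒟.metric.chronologicalPast 𝒟.timeOrientation (docCharted d))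
    (hii : (O ∩ 𝒟.metric.chronologicalPast 𝒟.timeOrientation (docCharted d)) \ docCertifiedLate d R τ₁ ⊆
      𝒟.metric.causalPast 𝒟.timeOrientation (docCertifiedSlab d R τ₁))
    (hcore : ((𝒟.metric.causalPast 𝒟.timeOrientation (docHoleSlabs d R τ₁) ∪ docHoleTubes d R τ₁) ∩
          (O ∩ 𝒟.metric.chronologicalPast 𝒟.timeOrientation (docCharted d))) \
        recutCertifiedLate d M a Θ R' τ₁ ⊆
      𝒟.metric.causalPast 𝒟.timeOrientation (recutCertifiedSlab d M a Θ R' τ₁)) :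
    O' \ recutCertifiedLate d M a Θ R' τ₁ ⊆
      𝒟.metric.causalPast 𝒟.timeOrientation (recutCertifiedSlab d M a Θ R' τ₁) := by
  intro p hp
  by_cases hlate : p ∈ docCertifiedLate d R τ₁
  · rw [docCertifiedLate_eq] at hlate
    rcases hlate with hflat | htube
    · exact (hp.2 (Or.inl hflat)).elim
    · exact hcore ⟨⟨Or.inr htube, hO' hp.1⟩, hp.2⟩
  · have h := hii ⟨hO' hp.1, hlate⟩
    rw [docCertifiedSlab_eq] at h
    rcases causalPast_union_subset _ _ h with hflat | hslab
    · exact LorentzianMetric.causalFuture_mono subset_union_left hflat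
    · exact hcore ⟨⟨Or.inl hslab, hO' hp.1⟩, hp.2⟩

/-- **The recut covering from the boost-honest junction core** (reshape m5; m2 oriented / m4 overlap forms): the wave-3 reductions
`recutJunction_of_core` (p125072) and `stub_recutCovering_of_transfer_of_junction` (p124807, with L1 =
`recutGrowingTransfer`) re-run verbatim with the three orientation binders and the eight clauses of `IsChartOverlapCompatible` threaded — expose the radii `R` of
`HasExhaustiveDocCharts' d`, take `s = W` beyond the thresholds of L1 and of the core, recut time
`τ₀' := max (max τJ τ₀) (τ₀ + ∑ᵢ |(τ₀ + Lᵢ)/cᵢ − τ₀|)`, clause (ii) by `recut_ii_of_core_at'` (restricted source), `(init)` by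
`recut_init_and_ii_of_ii`. -/
theorem recutCovering_of_coreB (hcore : SigM.stub_recutJunctionCoreB)
    {D : InitialDataSet (𝓡 3) X} (𝒟 : VacuumCauchyDevelopment D) (O : Set 𝒟.carrier)
    (d : StationaryFinalStateDecomposition 𝒟.toSpacetime O 2) (M a c r₀ : Fin d.N → ℝ) (Θ : Fin d.N → E4 → E4)
    (hO : O = Summit.FinalStateConjecture.exteriorOf 𝒟.toCauchyDevelopment d.charted)
    (hex : HasExhaustiveDocChartsB 𝒟 d) (hnorm : IsHorizonNormalised d) (hco : IsChartOverlapCompatibleB 𝒟 d)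
    (hreg : ∀ i, (d.hole i).horizon ⊆ Set.range (d.adapted i).toFun ∧
      ChartIsAsymptoticallyCartesian (d.adapted i) ∧ InTelescope (d.hole i))
    (hW : ∀ i, IsKerrChartedWith (d.hole i) (d.adapted i) (M i) (a i) (c i) (r₀ i) (Θ i))
    (hfut : ∀ i, ∀ u ∈ (Kerr.exterior (M i) (a i) : Set E4), ∀ h : Θ i u ∈ (d.adapted i).domain,
      (d.hole i).timeOrientation.IsFutureDirected
        (mfderiv 𝓘(ℝ, E4) (𝓡 4) (d.adapted i).toFun ⟨Θ i u, h⟩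
          (fderiv ℝ (Θ i) u (Kerr.timeVector (M i) (a i) u))))
    (hor₂ : ∀ (i : Fin d.N) (y : (d.background i).domain) (w : E4), d.toOver.τ₀ < (d.background i).time y.1 →
      (d.hole i).timeOrientation.IsFutureDirected
          (mfderiv 𝓘(ℝ, E4) (𝓡 4) (d.adapted i).toFun
            ⟨poincareInv (d.motion i).1 (d.motion i).2 y.1, ModelBackground.mem_boost_domain.1 y.2⟩
            (((d.motion i).1 : E4 ≃L[ℝ] E4).symm w)) →
        𝒟.metric.IsTimelike (mfderiv 𝓘(ℝ, E4) (𝓡 4) (d.toOver.chart i) y w) →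
          𝒟.timeOrientation.IsFutureDirected (mfderiv 𝓘(ℝ, E4) (𝓡 4) (d.toOver.chart i) y w))
    (hor₃ : ∀ y : d.toOver.flatDomain, d.toOver.τ₀ < (y : E4) 0 →
      𝒟.metric.IsTimelike (mfderiv 𝓘(ℝ, E4) (𝓡 4) d.toOver.flatChart y (E4.basisVector 0)) →
        𝒟.timeOrientation.IsFutureDirected (mfderiv 𝓘(ℝ, E4) (𝓡 4) d.toOver.flatChart y (E4.basisVector 0))) :
    KerrSchildRecutCovering 𝒟 d M a Θ := by
  intro hmaps
  obtain ⟨R, hRi, hRmono, hRtop, hRo, hRiii, hRiiic, hRa, hRb, hRii⟩ := hex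
  -- L1: the growing transfer, hole by hole
  have h1 := fun i ↦ recutGrowingTransfer 𝒟.toSpacetime (d.hole i) (d.adapted i) (d.motion i).1 (d.motion i).2
    (M i) (a i) (c i) (r₀ i) (Θ i) (d.toOver.chart i) (hmaps i) (R i) (d.toOver.isLateChart i).contMDiff (hW i)
    (hRmono i) (hRi i)
  choose s₀ hs₀ using h1
  -- the boost-honest core (m5)
  obtain ⟨hcoe, hcoe', hcol, hcon⟩ := hco
  obtain ⟨s₁, hs₁⟩ := hcore X D 𝒟 O d M a c r₀ Θ R hO hRi hRmono hRtop hRo hRiii hRiiic hRii hnorm hreg hW hfut hor₂ hor₃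
    hRa hRb hcoe hcoe' hcol hcon
  obtain ⟨S, hS⟩ := Finite.exists_le s₀
  set s : ℝ := max s₁ S with hs
  obtain ⟨τJ, hJ⟩ := hs₁ s s (le_max_left _ _) (le_max_left _ _)
  -- L2: the junction from the core (body of `recutJunction_of_core`)
  choose L hL using fun i ↦ kerrChartedWith_tilt_bound _ _ _ _ _ _ _ (hW i)
  set τ₀' : ℝ := max (max τJ d.toOver.τ₀) (d.toOver.τ₀ + ∑ j, |(d.toOver.τ₀ + L j) / c j - d.toOver.τ₀|)
    with hτ₀'
  have hO'E : Summit.FinalStateConjecture.exteriorOf 𝒟.toCauchyDevelopment (recutCharted d M a Θ τ₀') ⊆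
      O ∩ 𝒟.metric.chronologicalPast 𝒟.timeOrientation (docCharted d) := fun p hp ↦ by
    have h := exteriorOf_recutCharted_subset 𝒟.toCauchyDevelopment d hW hL (le_max_right _ _) hp
    refine ⟨?_, h.2⟩
    rw [hO]
    exact exteriorOf_mono _ (docCharted_subset_charted d) h
  have hτ₀τ₀' : d.toOver.τ₀ ≤ τ₀' := (le_max_right _ _).trans (le_max_left _ _)
  have hii : ∀ τ₁ : ℝ, τ₀' < τ₁ →
      Summit.FinalStateConjecture.exteriorOf 𝒟.toCauchyDevelopment (recutCharted d M a Θ τ₀') \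
          recutCertifiedLate d M a Θ (fun i τ ↦ R i (c i * τ - s) - s) τ₁ ⊆
        𝒟.metric.causalPast 𝒟.timeOrientation
          (recutCertifiedSlab d M a Θ (fun i τ ↦ R i (c i * τ - s) - s) τ₁) := fun τ₁ hτ₁ ↦ by
    have hτJ : τJ < τ₁ := ((le_max_left _ _).trans (le_max_left _ _)).trans_lt hτ₁
    have hτ₀ : d.toOver.τ₀ < τ₁ := hτ₀τ₀'.trans_lt hτ₁
    exact recut_ii_of_core_at' 𝒟.toCauchyDevelopment d M a Θ R _ τ₁ hO'E (hRii τ₁ hτ₀) (hJ τ₁ hτJ)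
  -- (init) and (ii) after bumping the recut time by one
  obtain ⟨hinit, hii'⟩ := recut_init_and_ii_of_ii 𝒟.toCauchyDevelopment d M a Θ
    (fun i τ ↦ R i (c i * τ - s) - s) τ₀' hii
  refine ⟨τ₀' + 1, fun i τ ↦ R i (c i * τ - s) - s, hτ₀τ₀'.trans (le_add_of_nonneg_right zero_le_one),
    fun i ↦ tendsto_transportedRadius (hRtop i) (hW i).2.1 s s,
    fun i ↦ hs₀ i s s ((hS i).trans (le_max_right _ _)) ((hS i).trans (le_max_right _ _)), hinit, hii'⟩

/-- **Stub 4 from the Chruściel–Delay fact and its r6 residual** (wave 3, p124601 + p124620). -/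
theorem moncriefFacts_of_fact_of_singleDetection
    (hCD : Literature.Geometry.Lorentzian.ChruscielDelay_localConstraintDeformation)
    (hSD : ∀ (X : Type) [TopologicalSpace X] [ChartedSpace E3 X] [IsManifold (𝓡 3) ∞ X] [T2Space X]
      [SecondCountableTopology X] [ConnectedSpace X] (D : InitialDataSet (𝓡 3) X)
      (𝒟 : VacuumCauchyDevelopment D) (x₀ : X), LocalSingleDetectionAt 𝒟 x₀) : Sig.stub_moncriefFacts :=
  stub_moncriefFacts_of_facts (localConstraintDeformationAt_of_fact hCD) hSD

/-- **Moncrief transversality, corrected form, from the two facts** (the landed reduction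
`stub_moncriefTransversality_of_localDeformation`, p105738, fed with `stub_moncriefFacts`). -/
theorem moncriefTransversality_of_facts (hM : Sig.stub_moncriefFacts)
    {D : InitialDataSet (𝓡 3) X} (hD : D ∈ admissibleVacuumData X) (𝒟 : VacuumCauchyDevelopment D)
    (x₀ : X) {k : ℕ} (A B : Fin k → BilinField X) (hdet : AreSymmDetectorsAt 𝒟 x₀ A B)
    (V : Set X) (hV : IsOpen V) (hxV : x₀ ∈ V) :
    ∃ G : EuclideanSpace ℝ (Fin k) → InitialDataSet (𝓡 3) X,
      InitialDataSet.IsSmoothDataFamily k G ∧ G 0 = D ∧ (∀ c, G c ∈ admissibleVacuumData X) ∧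
      (∃ K : Set X, IsCompact K ∧ K ⊆ V ∧ K ⊆ (extChartAt (𝓡 3) x₀).source ∧
        IsSupportedIn D G K) ∧
      (pairingMatrix D x₀ A B G).det ≠ 0 :=
  stub_moncriefTransversality_of_localDeformation X D hD 𝒟 x₀ k A B hdet.2.2 hdet.1 hdet.2.1
    (hM.1 X D 𝒟 x₀) (hM.2 X D 𝒟 x₀) V hV hxV

/-- **Settling (T2 d.o.c. sense) PRESENTABLY to mode-stable holes ⇒ the RE-TYPED summit property**, given X =
`KerrOrBombModT` (each limit hole, being in the rev-6 telescope and Killing-mode-stable, is a sub-extremal Kerr exterior: the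
DOCK), the rigidity of that identification in the settling chart (stub 1R via F3 ∧ F4), its future-preservation (F5), the
covering clauses of the recut (stub 1G, m5 boost-honest core), the T2 chart transfer over clause (ii) (`chartTransferT2_of_ii`,
the landed p136225 re-run) and MGHD existence. -/
theorem summitPropertyT2_of_settlesDocWithT2 (hX : KerrOrBombModT) (hR : Sig4.stub_kerrIsometryRigidity)
    (hF5 : Sig7.stub_kerrIdentificationFuture) (hJCO : SigM.stub_recutJunctionCoreB)
    (hMGHD : Summit.FinalStateConjecture.FinalStateConjecture.Theses.SwallowTheDatum.MGHDExists)
    {D : InitialDataSet (𝓡 3) X} (hD : D ∈ admissibleVacuumData X) (h : SettlesDocWithT2 ModeStableModT X D) :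
    SummitPropertyT2 X D := by
  refine ⟨hMGHD X D hD, fun 𝒟 h𝒟 ↦ ?_⟩
  obtain ⟨hcni, O, d, hO, hex, hnorm, hrays, hor, hco, hholes⟩ := h 𝒟 h𝒟
  refine ⟨hcni, ?_⟩
  have hKerr : ∀ i, ∃ (M a c r₀ : ℝ) (Θ : E4 → E4),
      IsKerrChartedWith (d.hole i) (d.adapted i) M a c r₀ Θ := fun i ↦
    hR (d.hole i) (d.adapted i) (hholes i).2.2.2.1 (hholes i).2.2.2.2.1 (hholes i).1 (hholes i).2.1
      (hholes i).2.2.1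
      (isKerrExterior_of_kerrOrBombModT hX (d.hole i) (hholes i).2.2.2.2.2.1 (hholes i).2.2.2.2.2.2)
  choose M a c r₀ Θ hW using hKerr
  have hreg : ∀ i, (d.hole i).horizon ⊆ Set.range (d.adapted i).toFun ∧
      ChartIsAsymptoticallyCartesian (d.adapted i) ∧ InTelescope (d.hole i) := fun i ↦
    ⟨(hholes i).1, (hholes i).2.1, (hholes i).2.2.2.1⟩
  have hfut : ∀ i, ∀ u ∈ (Kerr.exterior (M i) (a i) : Set E4), ∀ h : Θ i u ∈ (d.adapted i).domain,
      (d.hole i).timeOrientation.IsFutureDirected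
        (mfderiv 𝓘(ℝ, E4) (𝓡 4) (d.adapted i).toFun ⟨Θ i u, h⟩
          (fderiv ℝ (Θ i) u (Kerr.timeVector (M i) (a i) u))) :=
    fun i u hu h ↦ hF5 (d.hole i) (d.adapted i) (M i) (a i) (c i) (r₀ i) (Θ i) (hholes i).2.2.2.1 (hW i) u hu h
  have hcov : KerrSchildRecutCovering 𝒟 d M a Θ :=
    recutCovering_of_coreB hJCO 𝒟 O d M a c r₀ Θ hO hex hnorm hco hreg hW hfut hor.2.1 hor.2.2
  obtain ⟨R, -, -, -, -, -, -, -, -, hii⟩ := hex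
  obtain ⟨O', d', hsub, hO', hrays', hex', hfo'⟩ :=
    chartTransferT2_of_ii X D 𝒟 O d M a c r₀ Θ hO ⟨R, hii⟩ hnorm hW hfut hcov hrays hor
  exact ⟨O', d', hsub, hO', hrays', hex', hfo'⟩

/-- **A presentably settling datum (T2 d.o.c. sense, holes in the rev-6 telescope) that does not settle to mode-stable
presentable holes carries a BOMB**: some MGHD, some exhaustive regular horizon-normalised T2 decomposition of its exterior with
presentable holes, some hole which is not Killing-mode-stable (classical logic). -/
theorem exists_bomb_docModT {D : InitialDataSet (𝓡 3) X} (hS : SettlesDocWithT2 InTelescopeModT X D)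
    (hnot : ¬ SettlesDocWithT2 ModeStableModT X D) :
    ∃ (𝒟 : VacuumCauchyDevelopment D), 𝒟.IsMaximal ∧
      Summit.FinalStateConjecture.HasCompleteNullInfinity 𝒟.toCauchyDevelopment ∧
      ∃ (O : Set 𝒟.carrier) (d : StationaryFinalStateDecomposition 𝒟.toSpacetime O 2),
        O = Summit.FinalStateConjecture.exteriorOf 𝒟.toCauchyDevelopment d.charted ∧
        HasExhaustiveDocChartsB 𝒟 d ∧ IsHorizonNormalised d ∧
        Summit.FinalStateConjecture.RaysStayInClosure 𝒟.toCauchyDevelopment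
          (O ∩ 𝒟.metric.chronologicalPast 𝒟.timeOrientation (docCharted d)) ∧
        IsOrientationCompatible 𝒟 d ∧
        (∀ i, (d.hole i).horizon ⊆ Set.range (d.adapted i).toFun ∧
          ChartIsAsymptoticallyCartesian (d.adapted i) ∧
            ChartIsAsymptoticallySchwarzschildean' (d.adapted i) ∧
              InTelescope (d.hole i) ∧ (d.hole i).IsIPlusRegular ∧ InTelescopeModT (d.hole i)) ∧
        ∃ i, ¬ ModeStable (d.hole i) := by
  by_contra hcon
  apply hnot
  intro 𝒟 h𝒟
  obtain ⟨hcni, O, d, hO, hex, hnorm, hrays, hor, hco, hholes⟩ := hS 𝒟 h𝒟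
  refine ⟨hcni, O, d, hO, hex, hnorm, hrays, hor, hco, fun i ↦ ⟨(hholes i).1, (hholes i).2.1, (hholes i).2.2.1,
    (hholes i).2.2.2.1, (hholes i).2.2.2.2.1, (hholes i).2.2.2.2.2, ?_⟩⟩
  by_contra hi
  exact hcon ⟨𝒟, h𝒟, hcni, O, d, hO, hex, hnorm, hrays, hor, fun j ↦ ⟨(hholes j).1, (hholes j).2.1,
    (hholes j).2.2.1, (hholes j).2.2.2.1, (hholes j).2.2.2.2.1, (hholes j).2.2.2.2.2⟩, i, hi⟩

omit [T2Space X] [SecondCountableTopology X] [ConnectedSpace X] in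
/-- **Steering curves inside a compactly supported deformation family are TAME** (the T2 glue for stub 5): if every
member of the jointly smooth curve `F` through the admissible datum `D = F 0` is a member of a family `G` supported in a
compact set `K` (`IsSupportedIn D G K`), then `F` is tame on a collared restriction of the sole end of `D`
(`isTameDataFamily_restrict_of_agree_off_compact_one`, TameFamilyOffCompact.lean). -/
theorem exists_isTameDataFamily_of_steer [T2Space X] [SecondCountableTopology X] [ConnectedSpace X]
    {D : InitialDataSet (𝓡 3) X} (hD : D ∈ admissibleVacuumData X)
    {F : EuclideanSpace ℝ (Fin 1) → InitialDataSet (𝓡 3) X} (hF : InitialDataSet.IsSmoothDataFamily 1 F)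
    (hF0 : F 0 = D) {k : ℕ} {G : EuclideanSpace ℝ (Fin k) → InitialDataSet (𝓡 3) X}
    (hFG : ∀ c, ∃ c', F c = G c') {K : Set X} (hK : IsCompact K) (hsupp : IsSupportedIn D G K) :
    ∃ e : AFEnd X, InitialDataSet.IsTameDataFamily e 1 F := by
  obtain ⟨-, e, M, hsole, hdecay⟩ := id hD
  have hR₁ : e.R < e.R + 1 := by linarith
  have hSAF : e.IsStronglyAsymptoticallyFlatDR (F 0) M := by rw [hF0]; exact hdecay
  refine ⟨e.restrict hR₁.le, InitialDataSet.isTameDataFamily_restrict_of_agree_off_compact_one hF hsole hSAF hK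
    (fun c x hx ↦ ?_) hR₁⟩
  obtain ⟨c', hc'⟩ := hFG c
  rw [hc', hF0]
  exact hsupp c' x hx

end Glue

/-! ## §4 The composition (kernel-checked; concludes the crux BY NAME over the RE-TYPED summit)

Hypotheses (m6): `MGHDExists` (item stmt-FinalStateConjecture-9937 of route SwallowTheDatum, by name), `WeakCosmicCensorshipTame`
(item stmt-FinalStateConjecture-17269 of route PhaseMixingCapture, by name — the crux SPLIT AT WEAK COSMIC CENSORSHIP in relative form,
crux-strategist s1) and the seven registered stub signatures of §2 (F4 and the junction core PROVED modulo the farm build). X =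
`KerrOrBombModT` is introduced by `intro` and consumed at the dock of every good member (`summitPropertyT2_of_settlesDocWithT2`).
Composition of genericities ALONG CURVES (`InitialDataSet.isTameChristodoulouGeneric_of_relative_exceptional`): for every tame
censored curve with summit-exceptional base `D = F 0`, a summit-good tame curve through `D` — Case A (D settles presentably: bomb;
A1 germ-KID-free point: Bridge + detectors + Moncrief family, window family made global by `exists_tameFamily_of_localWindow`;
A2 Killing germs everywhere: 2′-rel right disjunct) / Case B (D does not settle presentably: 2′-rel left disjunct, the censored
curve handed in). -/

/-- **`FinalStateFromKerrOrBomb_of`** — the symplectic dual of the bomb docked through `KerrOrBombModT`, split at weak cosmic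
censorship (shape m6): the crux `KerrOrBombModT → FinalStateConjecture` (RE-TYPED summit) from the seven registered stubs, one cited
fact, MGHD existence and tame weak cosmic censorship (both items by name), along censorship's witness curves. -/
theorem FinalStateFromKerrOrBomb_of
    (hMGHD : Summit.FinalStateConjecture.FinalStateConjecture.Theses.SwallowTheDatum.MGHDExists)
    (hWCC : Summit.FinalStateConjecture.FinalStateConjecture.Theses.PhaseMixingCapture.WeakCosmicCensorshipTame)
    (hHX : SigM.stub_kerrHorizonExtension) (hAR : SigM.stub_kerrAsymptoticRigidity)
    (hJCO : SigM.stub_recutJunctionCoreB)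
    (hN : SigM.stub_nonSettlingCureRel) (hP : Sig.stub_probeUniversality)
    (h4 : Sig7.stub_moncriefResiduals) (hE : SigM.stub_dualModeEjectionModT) :
    Summit.FinalStateConjecture.FinalStateConjecture.Theses.ZeroEnergyKerrOrBomb.FinalStateFromKerrOrBomb := by
  have hF5 : Sig7.stub_kerrIdentificationFuture := f5_discharged
  obtain ⟨hCD, hSD⟩ := h4
  have hR : Sig4.stub_kerrIsometryRigidity := kerrIsometryRigidity_of_F3_F4 hHX hAR
  have hM : Sig.stub_moncriefFacts := moncriefFacts_of_fact_of_singleDetection hCD hSD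
  intro hX X _ _ _ _ _ _
  show InitialDataSet.IsTameChristodoulouGeneric (admissibleVacuumData X) (SummitPropertyT2 X) 1
  have good : ∀ {D' : InitialDataSet (𝓡 3) X}, D' ∈ admissibleVacuumData X →
      SettlesDocWithT2 ModeStableModT X D' → SummitPropertyT2 X D' := fun hD' h ↦
    summitPropertyT2_of_settlesDocWithT2 hX hR hF5 hJCO hMGHD hD' h
  refine InitialDataSet.isTameChristodoulouGeneric_of_relative_exceptional ?_ (hWCC X) ?_
  · -- every admissible datum has a sole strongly asymptotically flat end
    intro d hd
    obtain ⟨-, e, M, hsole, hdecay⟩ := id hd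
    exact ⟨e, hsole, M, hdecay⟩
  · -- the exceptional-base hand-back along censored curves
    intro e₀ F₀ hF₀ hdich hadm₀ hcens hnotP
    have hD : F₀ 0 ∈ admissibleVacuumData X := hadm₀ 0
    by_cases hS : SettlesDocWithT2 InTelescopeModT X (F₀ 0)
    · -- Case A: the base datum settles presentably to regular holes of the rev-6 telescope; being exceptional, one is a bomb
      have key : ¬ SettlesDocWithT2 ModeStableModT X (F₀ 0) := fun h ↦ hnotP (good hD h)
      obtain ⟨𝒟, h𝒟, hcni, O, d, hO, hex, hnorm, hrays, hor, hreg, i, hbomb⟩ := exists_bomb_docModT hS key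
      by_cases hKID : ∃ x : X, IsKIDFreeAt 𝒟 x
      · -- Case A1: a germ-KID-free point exists — the Bridge, the dual-mode detectors, the Moncrief family
        obtain ⟨ν, ϖ, h₁, h₂, hν, hmode⟩ :=
          hP (d.hole i) (d.adapted i) (hreg i).2.2.2.1 (hreg i).1 hbomb
        obtain ⟨x₀, k, A, B, hdet, hsteer⟩ :=
          hE X (F₀ 0) hD 𝒟 h𝒟 hcni O d hO hex hnorm hrays hor hreg i ν ϖ h₁ h₂ hν hmode hKID
        obtain ⟨G, hGs, hG0, hGadm, ⟨K, hKc, -, hKsrc, hsupp⟩, hdetG⟩ :=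
          moncriefTransversality_of_facts hM hD 𝒟 x₀ A B hdet (extChartAt (𝓡 3) x₀).source
            (isOpen_extChartAt_source x₀) (mem_extChartAt_source x₀)
        obtain ⟨ε, F, hε, hF, himm, hF0, hFG, hinj, hgood⟩ :=
          hsteer G hGs hG0 hGadm ⟨K, hKc, hKsrc, hsupp⟩ hdetG
        have hFadm : ∀ c', F c' ∈ admissibleVacuumData X := fun c' ↦ by
          obtain ⟨c'', hc''⟩ := hFG c'
          rw [hc'']
          exact hGadm c''
        obtain ⟨e, htame⟩ := exists_isTameDataFamily_of_steer hD hF hF0 hFG hKc hsupp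
        obtain ⟨F', hF', hF'0, hinj', himm', hadm', hgood'⟩ :=
          InitialDataSet.exists_tameFamily_of_localWindow (P := SummitPropertyT2 X) htame himm hε hinj
            (fun c' _ ↦ hFadm c') (fun c' hc hcε ↦ good (hFadm c') (hgood c' hc hcε))
        exact ⟨e, F', hF', hF'0.trans hF0, hinj', himm', hadm', hgood'⟩
      · -- Case A2: a local Killing germ at every point — the cure stub (right disjunct), censored curve handed in
        push Not at hKID
        obtain ⟨e, F', htame, himm, hF'0, hinj, hadm', hgood⟩ :=
          hN X (F₀ 0) hD (Or.inr ⟨𝒟, h𝒟, hKID⟩) e₀ F₀ hF₀ hdich hadm₀ rfl hcens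
        exact ⟨e, F', htame, hF'0, hinj, himm, hadm', fun c hc ↦ good (hadm' c) (hgood c hc)⟩
    · -- Case B: the base datum does not settle presentably — the cure stub (left disjunct), censored curve handed in
      obtain ⟨e, F', htame, himm, hF'0, hinj, hadm', hgood⟩ :=
        hN X (F₀ 0) hD (Or.inl hS) e₀ F₀ hF₀ hdich hadm₀ rfl hcens
      exact ⟨e, F', htame, hF'0, hinj, himm, hadm', fun c hc ↦ good (hadm' c) (hgood c hc)⟩

/-! ## §5 Negative checks (what this skeleton is read against)

* Kill shape of the frame (refuter one-shot ATTACK.md §2, kernel `Wlocal.lean`): `¬ crux ↔ KerrOrBombModT ∧ ¬ FSC`; nothing here is of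
  that shape, and the composition USES `KerrOrBombModT` (at the dock, through the Bridge `stub_probeUniversality`: finding 3 of
  `NotesIdeator2.md` — a bridge-free line would leave X idle).
* The re-typed summit is NOT reachable from per-datum witness families alone (tame families on one fixed end, continuous mass: the
  burial of SwallowTheDatum is excluded by design, p126844); this skeleton produces its witnesses from compactly supported kicks
  (tame by `TameFamilyOffCompact`) or takes them from stub 2′.
  `stub_dualModeEjection_false_of_symmetricBomb`, `moncriefTransversality_false_of_kidFreePoint` on 10021): stub 5′ keeps r7's
  KID-free hypothesis and symmetric detectors; FarFieldFocusing constrains stub 2′ exactly as it constrained r7's stub 2. -/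

end Summit.FinalStateConjecture.FinalStateConjecture.Cruxes.FinalStateFromKerrOrBomb.SketchIdeator1

end
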